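import Literature.Geometry.Riemannian.AlmostNonnegativeCurvatureSmoothing
import Literature.Geometry.Riemannian.ConstantCurvaturePCO
import Literature.Geometry.Riemannian.RicciFlowScaling
import Literature.Geometry.Riemannian.HamiltonNonnegCurvatureOperator
import Literature.Geometry.Lorentzian.LeviCivitaCurvature
import Literature.Geometry.Lorentzian.CurvatureNaturality
import Literature.Geometry.Lorentzian.IsometryProofs
import Literature.Geometry.Riemannian.ChangGurskyYangProofs
import HarnessLib

/-!
# Almost non-negative curvature operator: proved complements
(topic `Literature/Geometry/Riemannian`; companion of `AlmostNonnegativeCurvatureSmoothing.lean`)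

The named fact `BamlerCabezasRivasWilking2019_cor3_nonnegativeCurvatureOperator` of
`AlmostNonnegativeCurvatureSmoothing.lean` (R. Bamler, E. Cabezas-Rivas, B. Wilking, *The Ricci
flow under almost non-negative curvature conditions*, Invent. Math. 217 (2019) 95–126,
arXiv:1707.03002, §1, Corollary 3, case (1): given `n, D, v₀` there is `ε > 0` such that a closed
`(Mⁿ, g)` with `diam ≤ D`, `vol ≥ v₀`, `Rm_g + ε I ≥ 0` admits a metric with `Rm ≥ 0`) is **not**
discharged here.  Its printed proof (arXiv p. 15) runs: a contradiction sequence
`Rm_{gᵢ} + (1/i) I ≥ 0`; Theorem 1 of the paper (Ricci flows `gᵢ(t)`, `t ∈ (0, τ(n, v₀)]`, with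
`|Rm| ≤ C/t`, `Rm ≥ −C/i`, proved in §§3–4 from Gaussian heat-kernel bounds for Ricci flows and
Perelman's pseudolocality); Hamilton's compactness theorem for flows; a Cheeger–Gromov limit
`(M_∞, g_∞(t))` with `Rm ≥ 0`, diffeomorphic to `Mᵢ` for large `i` by the diameter bound.  None of
these ingredients (nor the existence of the Levi-Civita connection, a named fact of
`Lorentzian/LeviCivita.lean`) is available in the tree, so the corollary stays a named fact.

What this file PROVES is the part of the logical structure around the corollary that the tree's
vocabulary supports — statements about its hypothesis class `Rm_g ≥ −ε`
(`HasCurvatureOperatorGe`) and its conclusion class `Rm ≥ 0` (`HasNonnegativeCurvatureOperator`):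

* `bivectorNormSq_eq_half_sum_sq`, `bivectorNormSq_nonneg`, `bivectorNormSq_eq_zero_iff` — for a
  positive definite `g_x`, `|φ|²_g = ½ Σᵢⱼ φ♭(eᵢ, eⱼ)² ≥ 0` in an orthonormal basis (the Gram
  identity `sum_sq_bivectorForm_eq` of `ConstantCurvaturePCO.lean`), with equality iff `φ♭ = 0`;
  hence `Rm ≥ −ε` is monotone in `ε` for Riemannian metrics (`HasCurvatureOperatorGeWith.mono`,
  `HasCurvatureOperatorGe.mono`: the `ε` of Corollary 3 may always be shrunk) and a metric with
  `Rm ≥ 0` satisfies the hypothesis `Rm ≥ −ε` of the corollary for every `ε ≥ 0`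
  (`HasNonnegativeCurvatureOperator.hasCurvatureOperatorGe`).
* `two_mul_sum_apply_eq_of_antisymm`, `two_mul_sum_curvatureForm_eq` — for `φ = Σₐ Xₐ ∧ Yₐ` and a
  basis `b`, `2 Σₐ Rm(Xₐ, Yₐ, Z, W) = Σᵢⱼ φⁱʲ Rm(bᵢ, bⱼ, Z, W)` (only the antisymmetry of `Rm` in
  its first two slots is used), so `Rm(φ, φ)` depends on the pairs `(Xₐ, Yₐ)` only through the
  2-vector `φ`; in particular `φ♭ = 0 ⇒ Rm(φ, φ) = 0`
  (`curvatureOperatorForm_eq_zero_of_forall_bivectorForm_eq_zero`, any nondegenerate `g`), which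
  closes the gap between Hamilton's "`Rm(φ, φ) > 0` for `φ ≠ 0`" and "`Rm(φ, φ) ≥ 0` for all `φ`":
  **positive curvature operator implies non-negative curvature operator**
  (`HasPositiveCurvatureOperator.hasNonnegativeCurvatureOperator`; Hamilton 1986, p. 153), so the
  hypothesis class of Hamilton's Thm. 1.1 lies in the conclusion class `𝒞 = (1)` of Corollary 3.
* `HasConstantSectionalCurvatureWith.curvatureOperatorForm_eq` — `Rm(φ, φ) = c |φ|²` for constant
  sectional curvature `c`: for `c = 1` this is the normalisation "`I` denotes the curvature
  operator of the unit round sphere" of the paper (p. 3), i.e. `|φ|²_g = I(φ, φ)`; constant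
  curvature `c` gives `Rm ≥ −ε` exactly for `ε ≥ −c`, and `c ≥ 0` gives `Rm ≥ 0`
  (`HasConstantSectionalCurvature.hasNonnegativeCurvatureOperator`); flat connections give `Rm ≥ 0`.
* Scaling (p. 3: "they hold for any metric after rescaling by a sufficiently large factor"):
  `Rm_{λg}(φ, φ) = λ Rm_g(φ, φ)`, `|φ|²_{λg} = λ² |φ|²_g`, so `Rm_g ≥ −ε ⇒ Rm_{λg} ≥ −ε/λ`
  (`HasCurvatureOperatorGe.constSmul`) and `Rm ≥ 0` is scale invariant.
* Dimensions `≤ 1`: the curvature form vanishes identically (two tangent vectors are parallel and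
  `R(X, X) = 0`), so every metric has `Rm ≥ 0` and **Corollary 3 holds in dimensions `0` and `1`
  with `g' = g` and any `ε`** (`BamlerCabezasRivasWilking2019_cor3_nonnegativeCurvatureOperator_of_le_one`,
  the degenerate cases of the printed `n ∈ ℕ`).

* Any Levi-Civita connection: for a `C^n` metric with `n ≥ 2` the curvature of every torsion-free
  `g`-compatible `cov` is `g.riemann` (`IsLeviCivita.curvature_eq_riemann`,
  `Lorentzian/LeviCivitaCurvature.lean`), so the `∀ cov`-quantified predicates reduce to any one
  Levi-Civita connection, in particular to the canonical `g.leviCivita`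
  (`hasCurvatureOperatorGe_iff_of_isLeviCivita`, `hasCurvatureOperatorGe_iff_leviCivita`,
  `hasNonnegativeCurvatureOperator_iff_leviCivita`).
* Composition with Hamilton 1986, Thm. 1.3 (the named fact `hamilton1986_nonnegCurvatureOperator_four`
  of `HamiltonNonnegCurvatureOperator.lean`), both facts taken as hypotheses: given `D, v₀ > 0`
  there is `ε > 0` such that a closed simply connected 4-manifold carrying a Riemannian metric with
  `diam ≤ D`, `vol ≥ v₀`, `Rm ≥ −ε` is diffeomorphic to `S⁴`, `ℂℙ²` or `S² × S²`, and to `S⁴` if it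
  is a homotopy 4-sphere (`BamlerCabezasRivasWilking2019_cor3_nonnegativeCurvatureOperator.simplyConnected_four`,
  `.sphere_of_homotopyEquiv_four` — the consumption shape of the `SmoothPoincare4` route that
  requested the fact).

* Consequences of `Rm ≥ −ε` used by the comparison geometry of the printed proof (the volume bound
  `vol B(p, 1) ≥ v₀'` of Theorem 1 from `vol(M) ≥ v₀`, `diam ≤ D` is Bishop–Gromov under
  `Ric ≥ −(n−1)ε`): `Rm(X, Y, Y, X) ≥ −ε (g(X,X) g(Y,Y) − g(X,Y)²)`
  (`HasCurvatureOperatorGeWith.curvatureForm_pair_ge`), sectional curvature `K ≥ −ε`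
  (`.sectionalCurvature_ge`), `Ric(X, X) ≥ −(n−1) ε g(X, X)` (`.ricci_ge`) and `R ≥ −n(n−1) ε`
  (`.scalarCurvatureWith_ge`) for positive definite `g_x`; in particular `Rm ≥ 0 ⇒ Ric ≥ 0, R ≥ 0`.

* The two purely logical/analytic steps of the printed proof of Corollary 3 (p. 15): (i) the
  contradiction set-up "a sequence of counterexamples with `Rm_{gᵢ} + (1/i) I ∈ 𝒞`" — the named
  fact is EQUIVALENT to its sequential form (for every sequence of closed `k`-manifolds with
  `diam ≤ D`, `vol ≥ v₀`, `Rm ≥ −1/(i+1)`, some member admits a metric with `Rm ≥ 0`;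
  `BamlerCabezasRivasWilking2019_cor3_nonnegativeCurvatureOperator_iff_seq`, using the monotonicity
  in `ε` and `exists_nat_one_div_lt`); (ii) "the curvature condition passes to the limit" — lower
  bounds `Rm ≥ −δᵢ`, `δᵢ → δ`, pass to pointwise limits of the curvature operator forms on a fixed
  manifold (`hasCurvatureOperatorGeWith_of_tendsto`). The analytic core in between (Theorem 1,
  Hamilton's compactness theorem, Cheeger–Gromov diffeomorphisms) is what the tree lacks.

* Step 5 of the printed proof ("the uniform diameter bound ensures that `M_∞` is diffeomorphic
  to `Mᵢ` for all `i` large enough", whence `Mᵢ` carries the pulled-back metric): the curvature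
  classes are transported along local diffeomorphisms — `|φ|²` and `Rm(φ, φ)` of the pullback
  metric `Φ^* g` (`PseudoRiemannianMetric.comap`, with the naturality `riemann_comap_apply` of
  `Lorentzian/CurvatureNaturality.lean`) are those of `g` on `dΦ φ`
  (`bivectorNormSq_comap`, `curvatureOperatorForm_comap_leviCivita`), so `Rm_g ≥ −ε ⇒
  Rm_{Φ^*g} ≥ −ε` (`HasCurvatureOperatorGe.comap`, `HasNonnegativeCurvatureOperator.comap`,
  `IsRiemannian.comap`), and a manifold diffeomorphic to one admitting a Riemannian metric with
  `Rm ≥ −ε` admits one (`exists_isRiemannian_hasCurvatureOperatorGe_of_diffeomorph`).  Hence the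
  named fact follows from the bare output of Theorem 1 + Hamilton's compactness theorem: for every
  sequence as above, a smooth `k`-manifold `M_∞` with a Riemannian `Rm ≥ 0` metric diffeomorphic
  to some `Mᵢ` (`BamlerCabezasRivasWilking2019_cor3_nonnegativeCurvatureOperator_of_limit`).

* Finally the hypothesis of `…_of_limit` is split along the two theorems the printed proof quotes
  (`BamlerCabezasRivasWilking2019_cor3_nonnegativeCurvatureOperator_of_ricciFlow_of_compactness`):
  (H1) the Ricci-flow smoothing — Theorem 1 of the paper on closed manifolds, with the
  Bishop–Gromov step `vol(M) ≥ v₀ ∧ diam ≤ D ∧ Rm ≥ −1 ⇒ vol B(p,1) ≥ v₀'` folded into its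
  hypotheses: uniform `τ, C` and a Ricci flow (`IsRicciFlow`, `RicciFlow.lean`) `g(t)`,
  `t ∈ [0, τ]`, from `g` with `Rm_{g(t)} ≥ −Cε` and `|Rm_{g(t)}(φ, φ)| ≤ (C/t) |φ|²`; (H2) the
  compactness step — Hamilton's compactness theorem for such flows with the passage of
  `Rm ≥ −C/(i+1)` to the limit and the diffeomorphisms `Mᵢ ≅ M_∞` under the diameter bound.
  Both are hypotheses of a proved theorem, not named facts; neither is available in the tree.

* The normalisation, verified on the model: for the unit round sphere `Sᵐ ⊂ V`
  (`roundMetric`, `RoundSphere.lean`; constant curvature `1` proved in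
  `ChangGurskyYangProofs.lean`) and any of its Levi-Civita connections, `Rm(φ, φ) = |φ|²`
  (`curvatureOperatorForm_roundMetric`) — i.e. `bivectorNormSq` IS the quadratic form of "`I`,
  the curvature operator of the unit round `n`-sphere" (p. 3) — and the round sphere lies in
  curvature condition (1) and satisfies `Rm ≥ −ε` for every `ε ≥ −1`
  (`hasNonnegativeCurvatureOperator_roundMetric`, `hasCurvatureOperatorGe_roundMetric`).

Everything here is proved; no facts are vended.

## References

* R. H. Bamler, E. Cabezas-Rivas, B. Wilking, Invent. Math. 217 (2019) 95–126, arXiv:1707.03002: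
  §1, Theorem 1, Theorem 2 (1), Corollary 3 (statement p. 3; proof p. 15).
  [`BamlerCabezasrivasWilking2019`]
* R. S. Hamilton, *Four-manifolds with positive curvature operator*, J. Differential Geom. 24
  (1986) 153–179, p. 153 (positive / nonnegative curvature operator). [`Hamilton1986`]
* J. M. Lee, *Introduction to Riemannian Manifolds*, 2nd ed. (2018), Prop. 8.36 (constant
  curvature), Ch. 8 (the curvature operator on `Λ²`). [`Lee2018`]
-/

noncomputable section

open Bundle Finset Module
open scoped Manifold ContDiff Topology BigOperators

namespace Literature.Geometry.Riemannian

open Literature.Geometry.Lorentzian (PseudoRiemannianMetric)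
open Literature.Geometry.Lorentzian.PseudoRiemannianMetric

/-! ### Linear algebra: an antisymmetric bilinear form summed over a 2-vector -/

/-- For an antisymmetric bilinear form `B` on a real vector space with basis `b`, and a 2-vector
`φ = Σₐ Xₐ ∧ Yₐ` given by finitely many pairs: `2 Σₐ B(Xₐ, Yₐ) = Σᵢⱼ φⁱʲ B(bᵢ, bⱼ)` where
`φⁱʲ = Σₐ (Xₐⁱ Yₐʲ − Yₐⁱ Xₐʲ)` are the coefficients of `φ` in the basis `(bᵢ ∧ bⱼ)`; i.e. the sum
depends on the pairs only through `φ ∈ Λ²` (universal property of `Λ²`, in coordinates).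
[folklore] -/
theorem two_mul_sum_apply_eq_of_antisymm {V : Type*} [AddCommGroup V] [Module ℝ V]
    {ι : Type*} [Fintype ι] (b : Basis ι ℝ V) (B : V →ₗ[ℝ] V →ₗ[ℝ] ℝ)
    (hB : ∀ u v, B u v = -B v u) {m : ℕ} (X Y : Fin m → V) :
    2 * ∑ a, B (X a) (Y a) =
      ∑ i, ∑ j, (∑ a, (b.repr (X a) i * b.repr (Y a) j - b.repr (Y a) i * b.repr (X a) j)) *
        B (b i) (b j) := by
  -- expansion of `B u v` in the basis
  have hexp : ∀ u v : V, B u v = ∑ i, ∑ j, b.repr u i * b.repr v j * B (b i) (b j) := by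
    intro u v
    have hu : B u = ∑ i, b.repr u i • B (b i) := by
      conv_lhs => rw [← b.sum_repr u]
      rw [map_sum]
      exact Finset.sum_congr rfl fun i _ ↦ by rw [map_smul]
    rw [hu, LinearMap.sum_apply]
    refine Finset.sum_congr rfl fun i _ ↦ ?_
    rw [LinearMap.smul_apply, smul_eq_mul]
    have hv : B (b i) v = ∑ j, b.repr v j * B (b i) (b j) := by
      conv_lhs => rw [← b.sum_repr v]
      rw [map_sum]
      exact Finset.sum_congr rfl fun j _ ↦ by rw [map_smul, smul_eq_mul]
    rw [hv, Finset.mul_sum]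
    exact Finset.sum_congr rfl fun j _ ↦ by ring
  set P : ι → ι → ℝ := fun i j ↦ ∑ a, b.repr (X a) i * b.repr (Y a) j with hP
  have hS : ∑ a, B (X a) (Y a) = ∑ i, ∑ j, P i j * B (b i) (b j) := by
    calc ∑ a, B (X a) (Y a)
        = ∑ a, ∑ i, ∑ j, b.repr (X a) i * b.repr (Y a) j * B (b i) (b j) :=
          Finset.sum_congr rfl fun a _ ↦ hexp _ _
      _ = ∑ i, ∑ j, ∑ a, b.repr (X a) i * b.repr (Y a) j * B (b i) (b j) :=
          sum_sum_sum_comm _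
      _ = ∑ i, ∑ j, P i j * B (b i) (b j) := by
          refine Finset.sum_congr rfl fun i _ ↦ Finset.sum_congr rfl fun j _ ↦ ?_
          rw [hP, Finset.sum_mul]
  have hS' : ∑ a, B (X a) (Y a) = -∑ i, ∑ j, P j i * B (b i) (b j) := by
    rw [hS, Finset.sum_comm, ← Finset.sum_neg_distrib]
    refine Finset.sum_congr rfl fun j _ ↦ ?_
    rw [← Finset.sum_neg_distrib]
    refine Finset.sum_congr rfl fun i _ ↦ ?_
    rw [hB (b i) (b j)]
    ring
  have hcoef : ∀ i j,
      (∑ a, (b.repr (X a) i * b.repr (Y a) j - b.repr (Y a) i * b.repr (X a) j)) =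
        P i j - P j i := by
    intro i j
    simp only [hP, ← Finset.sum_sub_distrib]
    exact Finset.sum_congr rfl fun a _ ↦ by ring
  calc 2 * ∑ a, B (X a) (Y a)
      = ∑ i, ∑ j, P i j * B (b i) (b j) + -∑ i, ∑ j, P j i * B (b i) (b j) := by
        rw [two_mul]
        nth_rewrite 1 [hS]
        rw [hS']
    _ = ∑ i, ∑ j, (P i j - P j i) * B (b i) (b j) := by
        rw [← Finset.sum_neg_distrib, ← Finset.sum_add_distrib]
        refine Finset.sum_congr rfl fun i _ ↦ ?_
        rw [← Finset.sum_neg_distrib, ← Finset.sum_add_distrib]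
        exact Finset.sum_congr rfl fun j _ ↦ by ring
    _ = _ := Finset.sum_congr rfl fun i _ ↦ Finset.sum_congr rfl fun j _ ↦ by rw [hcoef]

section Pointwise

variable {E : Type*} [NormedAddCommGroup E] [NormedSpace ℝ E] {H : Type*} [TopologicalSpace H]
  {I : ModelWithCorners ℝ E H} {M : Type*} [TopologicalSpace M] [ChartedSpace H M]
  [IsManifold I ∞ M] {n : ℕ∞ω}
  {g : PseudoRiemannianMetric I n E (TangentSpace I : M → Type _)}
  {cov : CovariantDerivative I E (TangentSpace I : M → Type _)} {x : M}

/-! ### `|φ|²` in an orthonormal basis; non-negativity -/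

/-- **`|φ|² = ½ Σᵢⱼ φ♭(eᵢ, eⱼ)²`** in a `g_x`-orthonormal basis `e` (the Gram identity
`sum_sq_bivectorForm_eq`): the squared norm of a 2-vector is half the sum of the squares of its
components. [folklore] -/
theorem _root_.Literature.Geometry.Lorentzian.PseudoRiemannianMetric.bivectorNormSq_eq_half_sum_sq
    {ι : Type*} [Fintype ι] (b : Basis ι ℝ (TangentSpace I x)) (hb : g.IsOrthonormalFrame x b)
    {m : ℕ} (X Y : Fin m → TangentSpace I x) :
    g.bivectorNormSq x X Y = (1 / 2) * ∑ i, ∑ j, (g.bivectorForm x X Y (b i) (b j)) ^ 2 := by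
  rw [g.sum_sq_bivectorForm_eq b hb X Y]
  simp only [bivectorNormSq]
  ring

/-- **`|φ|²_g ≥ 0` when `g_x` is positive definite** (in particular for Riemannian `g`): the
metric induced on `Λ² T_x M` by a positive definite `g_x` is positive semi-definite on the
expressions `Σₐ Xₐ ∧ Yₐ`. [folklore] -/
theorem _root_.Literature.Geometry.Lorentzian.PseudoRiemannianMetric.bivectorNormSq_nonneg
    [FiniteDimensional ℝ E] (hpos : ∀ v : TangentSpace I x, v ≠ 0 → 0 < g.val x v v) {m : ℕ}
    (X Y : Fin m → TangentSpace I x) : 0 ≤ g.bivectorNormSq x X Y := by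
  obtain ⟨b, hb⟩ := g.exists_basis_isOrthonormalFrame hpos rfl
  rw [g.bivectorNormSq_eq_half_sum_sq b hb X Y]
  exact mul_nonneg (by norm_num)
    (Finset.sum_nonneg fun i _ ↦ Finset.sum_nonneg fun j _ ↦ sq_nonneg _)

/-- **`|φ|²_g = 0` iff `φ♭ = 0`** (positive definite `g_x`): the induced metric on 2-vectors is
definite, `φ ≠ 0 ↔ |φ|² > 0`, with "`φ ≠ 0`" expressed as `φ♭ ≠ 0` as in `CurvatureOperator.lean`.
[folklore] -/
theorem _root_.Literature.Geometry.Lorentzian.PseudoRiemannianMetric.bivectorNormSq_eq_zero_iff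
    [FiniteDimensional ℝ E] (hpos : ∀ v : TangentSpace I x, v ≠ 0 → 0 < g.val x v v) {m : ℕ}
    (X Y : Fin m → TangentSpace I x) :
    g.bivectorNormSq x X Y = 0 ↔ ∀ v w : TangentSpace I x, g.bivectorForm x X Y v w = 0 := by
  obtain ⟨b, hb⟩ := g.exists_basis_isOrthonormalFrame hpos rfl
  rw [g.bivectorNormSq_eq_half_sum_sq b hb X Y]
  constructor
  · intro h v w
    have h0 : ∑ i, ∑ j, (g.bivectorForm x X Y (b i) (b j)) ^ 2 = 0 := by linarith
    have hij : ∀ i j, g.bivectorForm x X Y (b i) (b j) = 0 := by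
      intro i j
      have h1 := (Finset.sum_eq_zero_iff_of_nonneg
        (fun i _ ↦ Finset.sum_nonneg fun j _ ↦ sq_nonneg (g.bivectorForm x X Y (b i) (b j)))).1
        h0 i (Finset.mem_univ i)
      have h2 := (Finset.sum_eq_zero_iff_of_nonneg
        (fun j _ ↦ sq_nonneg (g.bivectorForm x X Y (b i) (b j)))).1 h1 j (Finset.mem_univ j)
      exact pow_eq_zero_iff two_ne_zero |>.1 h2
    rw [g.bivectorForm_eq_sum_repr b X Y v w]
    exact Finset.sum_eq_zero fun i _ ↦ Finset.sum_eq_zero fun j _ ↦ by rw [hij i j, mul_zero]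
  · intro h
    simp [h]

/-- `|φ|²_g > 0` for `φ ≠ 0` (`φ♭ ≠ 0`), positive definite `g_x`. [folklore] -/
theorem _root_.Literature.Geometry.Lorentzian.PseudoRiemannianMetric.bivectorNormSq_pos
    [FiniteDimensional ℝ E] (hpos : ∀ v : TangentSpace I x, v ≠ 0 → 0 < g.val x v v) {m : ℕ}
    (X Y : Fin m → TangentSpace I x) (hφ : ∃ v w : TangentSpace I x, g.bivectorForm x X Y v w ≠ 0) :
    0 < g.bivectorNormSq x X Y := by
  rcases (g.bivectorNormSq_nonneg hpos X Y).lt_or_eq with h | h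
  · exact h
  · exfalso
    obtain ⟨v, w, hvw⟩ := hφ
    exact hvw ((g.bivectorNormSq_eq_zero_iff hpos X Y).1 h.symm v w)

/-! ### Monotonicity of `Rm ≥ −ε` in `ε` (Riemannian metrics) -/

/-- For a Riemannian metric, `Rm ≥ −ε` with `ε ≤ ε'` gives `Rm ≥ −ε'` (pair form): the `ε` of
Bamler–Cabezas-Rivas–Wilking's Corollary 3 may be shrunk. [cite: BamlerCabezasrivasWilking2019, §1 (Theorem 1: Rm ≥ −ε ≥ −1)] -/
theorem _root_.Literature.Geometry.Lorentzian.PseudoRiemannianMetric.HasCurvatureOperatorGeWith.mono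
    [FiniteDimensional ℝ E] {ε ε' : ℝ} (h : g.HasCurvatureOperatorGeWith cov ε)
    (hg : g.IsRiemannian) (hle : ε ≤ ε') : g.HasCurvatureOperatorGeWith cov ε' :=
  fun x _ X Y ↦ h.mono_of_nonneg hle x X Y (g.bivectorNormSq_nonneg (fun v hv ↦ hg x v hv) X Y)

/-- For a Riemannian metric, `Rm_g ≥ −ε` with `ε ≤ ε'` gives `Rm_g ≥ −ε'`.
[cite: BamlerCabezasrivasWilking2019, §1 (Theorem 1: Rm ≥ −ε ≥ −1)] -/
theorem _root_.Literature.Geometry.Lorentzian.PseudoRiemannianMetric.HasCurvatureOperatorGe.mono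
    [FiniteDimensional ℝ E] [CompleteSpace E] {ε ε' : ℝ} (h : g.HasCurvatureOperatorGe ε)
    (hg : g.IsRiemannian) (hle : ε ≤ ε') : g.HasCurvatureOperatorGe ε' :=
  fun cov hcov ↦ (h cov hcov).mono hg hle

/-- A Riemannian metric with non-negative curvature operator satisfies `Rm ≥ −ε` for every
`ε ≥ 0`: the metrics in the conclusion class of Corollary 3 lie in its hypothesis class for
every `ε`. [cite: BamlerCabezasrivasWilking2019, Corollary 3 (case (1))] -/
theorem _root_.Literature.Geometry.Lorentzian.PseudoRiemannianMetric.HasNonnegativeCurvatureOperator.hasCurvatureOperatorGe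
    [FiniteDimensional ℝ E] [CompleteSpace E] (h : g.HasNonnegativeCurvatureOperator)
    (hg : g.IsRiemannian) {ε : ℝ} (hε : 0 ≤ ε) : g.HasCurvatureOperatorGe ε :=
  HasCurvatureOperatorGe.mono h hg hε

/-! ### `Rm(φ, φ)` depends only on `φ`; positive ⇒ non-negative curvature operator -/

variable (g cov) in
/-- **`2 Σₐ Rm(Xₐ, Yₐ, Z, W) = Σᵢⱼ φⁱʲ Rm(bᵢ, bⱼ, Z, W)`** for `φ = Σₐ Xₐ ∧ Yₐ` and any basis `b` of
`T_x M`, `φⁱʲ = Σₐ (Xₐⁱ Yₐʲ − Yₐⁱ Xₐʲ)`: the contraction of the curvature with a 2-vector is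
well defined on `Λ² T_x M` (uses only `R(X, Y) = −R(Y, X)`). [folklore] -/
theorem _root_.Literature.Geometry.Lorentzian.PseudoRiemannianMetric.two_mul_sum_curvatureForm_eq
    {ι : Type*} [Fintype ι] (b : Basis ι ℝ (TangentSpace I x)) {m : ℕ}
    (X Y : Fin m → TangentSpace I x) (Z W : TangentSpace I x) :
    2 * ∑ a, g.curvatureForm cov x (X a) (Y a) Z W =
      ∑ i, ∑ j, (∑ a, (b.repr (X a) i * b.repr (Y a) j - b.repr (Y a) i * b.repr (X a) j)) *
        g.curvatureForm cov x (b i) (b j) Z W := by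
  let B : TangentSpace I x →ₗ[ℝ] TangentSpace I x →ₗ[ℝ] ℝ :=
    LinearMap.mk₂ ℝ (fun X₀ Y₀ ↦ g.curvatureForm cov x X₀ Y₀ Z W)
      (fun X₀ X₁ Y₀ ↦ by
        simp only [curvatureForm, map_add, _root_.add_apply])
      (fun c X₀ Y₀ ↦ by
        simp only [curvatureForm, map_smul, _root_.smul_apply, smul_eq_mul])
      (fun X₀ Y₀ Y₁ ↦ by
        simp only [curvatureForm, map_add, _root_.add_apply])
      (fun c X₀ Y₀ ↦ by
        simp only [curvatureForm, map_smul, _root_.smul_apply, smul_eq_mul])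
  have hB : ∀ u v, B u v = -B v u := fun u v ↦ g.curvatureForm_antisymm cov x u v Z W
  exact two_mul_sum_apply_eq_of_antisymm b B hB X Y

/-- **`φ♭ = 0 ⇒ Rm(φ, φ) = 0`**, for any (nondegenerate) `g`: if the alternating form of
`φ = Σₐ Xₐ ∧ Yₐ` vanishes then all coefficients `φⁱʲ` vanish (test `φ♭` on the `g`-dual vectors
`♯bⁱ` of a basis), hence `Σₐ Rm(Xₐ, Yₐ, ·, ·) = 0` and `Rm(φ, φ) = Σ_b Σₐ Rm(Xₐ, Yₐ, Y_b, X_b) = 0`.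
[folklore] -/
theorem _root_.Literature.Geometry.Lorentzian.PseudoRiemannianMetric.curvatureOperatorForm_eq_zero_of_forall_bivectorForm_eq_zero
    [FiniteDimensional ℝ E] {m : ℕ} {X Y : Fin m → TangentSpace I x}
    (hφ : ∀ v w : TangentSpace I x, g.bivectorForm x X Y v w = 0) :
    g.curvatureOperatorForm cov x X Y = 0 := by
  haveI : FiniteDimensional ℝ (TangentSpace I x) := ‹FiniteDimensional ℝ E›
  let b := Module.finBasis ℝ (TangentSpace I x)
  have hcoef : ∀ i j,
      (∑ a, (b.repr (X a) i * b.repr (Y a) j - b.repr (Y a) i * b.repr (X a) j)) = 0 := by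
    intro i j
    have key := hφ (g.sharp x (b.coord i)) (g.sharp x (b.coord j))
    simp only [bivectorForm] at key
    rw [← key]
    refine Finset.sum_congr rfl fun a _ ↦ ?_
    rw [g.symm x (X a) (g.sharp x _), g.symm x (Y a) (g.sharp x _), g.symm x (X a) (g.sharp x _),
      g.symm x (Y a) (g.sharp x _)]
    simp only [val_sharp_apply, Basis.coord_apply]
  have h2 : ∀ Z W : TangentSpace I x, ∑ a, g.curvatureForm cov x (X a) (Y a) Z W = 0 := by
    intro Z W
    have h := g.two_mul_sum_curvatureForm_eq cov b X Y Z W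
    rw [Finset.sum_eq_zero (fun i _ ↦ Finset.sum_eq_zero fun j _ ↦ by rw [hcoef i j, zero_mul])]
      at h
    linarith
  unfold curvatureOperatorForm
  rw [Finset.sum_comm]
  exact Finset.sum_eq_zero fun c _ ↦ h2 (Y c) (X c)

/-- **Positive curvature operator ⇒ non-negative curvature operator** (pair form): Hamilton's
`Rm(φ, φ) > 0` for `φ ≠ 0` (1986, p. 153) gives `Rm(φ, φ) ≥ 0` for all `φ`, the degenerate
`φ♭ = 0` having `Rm(φ, φ) = 0`. [cite: Hamilton1986, §1, p. 153] -/
theorem _root_.Literature.Geometry.Lorentzian.PseudoRiemannianMetric.HasPositiveCurvatureOperatorWith.hasCurvatureOperatorGeWith_zero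
    [FiniteDimensional ℝ E] (h : g.HasPositiveCurvatureOperatorWith cov) :
    g.HasCurvatureOperatorGeWith cov 0 := by
  intro x m X Y
  rw [neg_zero, zero_mul]
  by_cases hφ : ∃ v w : TangentSpace I x, g.bivectorForm x X Y v w ≠ 0
  · exact (h x m X Y hφ).le
  · push Not at hφ
    exact (curvatureOperatorForm_eq_zero_of_forall_bivectorForm_eq_zero (cov := cov) hφ).ge

/-- **Positive curvature operator ⇒ non-negative curvature operator**: the hypothesis class of
Hamilton 1986, Thm. 1.1 (`HasPositiveCurvatureOperator`) lies in curvature condition (1) of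
Bamler–Cabezas-Rivas–Wilking's Theorem 2 / Corollary 3 (`HasNonnegativeCurvatureOperator`).
[cite: Hamilton1986, §1, p. 153] [cite: BamlerCabezasrivasWilking2019, Theorem 2 (1)] -/
theorem _root_.Literature.Geometry.Lorentzian.PseudoRiemannianMetric.HasPositiveCurvatureOperator.hasNonnegativeCurvatureOperator
    [FiniteDimensional ℝ E] [CompleteSpace E] (h : g.HasPositiveCurvatureOperator) :
    g.HasNonnegativeCurvatureOperator :=
  fun cov hcov ↦ (h cov hcov).hasCurvatureOperatorGeWith_zero

/-! ### Constant sectional curvature: `Rm(φ, φ) = c |φ|²` -/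

/-- **`Rm(φ, φ) = c |φ|²`** for a pair `(g, cov)` of constant sectional curvature `c`; for `c = 1`
(the unit round sphere, Lee Thm. 8.34) this is the normalisation `I(φ, φ) = |φ|²` of "`Rm + ε I`"
in Bamler–Cabezas-Rivas–Wilking, §1. [cite: Lee2018, Prop. 8.36]
[cite: BamlerCabezasrivasWilking2019, §1 (remark after Theorem 1)] -/
theorem _root_.Literature.Geometry.Lorentzian.PseudoRiemannianMetric.HasConstantSectionalCurvatureWith.curvatureOperatorForm_eq
    {c : ℝ} (h : g.HasConstantSectionalCurvatureWith cov c) (x : M) {m : ℕ}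
    (X Y : Fin m → TangentSpace I x) :
    g.curvatureOperatorForm cov x X Y = c * g.bivectorNormSq x X Y := by
  simp only [curvatureOperatorForm, bivectorNormSq, h.curvatureForm_eq, Finset.mul_sum]
  exact Finset.sum_congr rfl fun a _ ↦ Finset.sum_congr rfl fun a' _ ↦ by ring

/-- Constant sectional curvature `c` (Riemannian `g`) gives `Rm ≥ −ε` for every `ε ≥ −c`; e.g.
hyperbolic space (`c = −1`) has `Rm ≥ −1`, the round sphere `Rm ≥ 0`.
[cite: BamlerCabezasrivasWilking2019, §1 (Theorem 1)] [cite: Lee2018, Prop. 8.36] -/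
theorem _root_.Literature.Geometry.Lorentzian.PseudoRiemannianMetric.HasConstantSectionalCurvatureWith.hasCurvatureOperatorGeWith
    [FiniteDimensional ℝ E] {c ε : ℝ} (h : g.HasConstantSectionalCurvatureWith cov c)
    (hg : g.IsRiemannian) (hε : -c ≤ ε) : g.HasCurvatureOperatorGeWith cov ε := by
  intro x m X Y
  rw [h.curvatureOperatorForm_eq]
  have h0 := g.bivectorNormSq_nonneg (fun v hv ↦ hg x v hv) X Y
  nlinarith

/-- Constant sectional curvature `c ≥ 0` (Riemannian `g`) gives non-negative curvature operator
for the pair. [cite: Lee2018, Prop. 8.36] [cite: Hamilton1986, §1, pp. 153–154] -/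
theorem _root_.Literature.Geometry.Lorentzian.PseudoRiemannianMetric.HasConstantSectionalCurvatureWith.hasCurvatureOperatorGeWith_zero
    [FiniteDimensional ℝ E] {c : ℝ} (h : g.HasConstantSectionalCurvatureWith cov c)
    (hg : g.IsRiemannian) (hc : 0 ≤ c) : g.HasCurvatureOperatorGeWith cov 0 :=
  h.hasCurvatureOperatorGeWith hg (by linarith)

/-- **A Riemannian metric of constant sectional curvature `c ≥ 0` has non-negative curvature
operator** (round spheres, flat tori: members of curvature condition (1)).
[cite: Hamilton1986, §1, pp. 153–154] [cite: BamlerCabezasrivasWilking2019, Theorem 2 (1)] -/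
theorem _root_.Literature.Geometry.Lorentzian.PseudoRiemannianMetric.HasConstantSectionalCurvature.hasNonnegativeCurvatureOperator
    [FiniteDimensional ℝ E] [CompleteSpace E] {c : ℝ} (h : g.HasConstantSectionalCurvature c)
    (hg : g.IsRiemannian) (hc : 0 ≤ c) : g.HasNonnegativeCurvatureOperator :=
  fun _ hcov ↦ (h.with hcov).hasCurvatureOperatorGeWith_zero hg hc

/-- A Riemannian metric of constant sectional curvature `c` satisfies `Rm_g ≥ −ε` for `ε ≥ −c`.
[cite: BamlerCabezasrivasWilking2019, §1 (Theorem 1)] -/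
theorem _root_.Literature.Geometry.Lorentzian.PseudoRiemannianMetric.HasConstantSectionalCurvature.hasCurvatureOperatorGe
    [FiniteDimensional ℝ E] [CompleteSpace E] {c ε : ℝ} (h : g.HasConstantSectionalCurvature c)
    (hg : g.IsRiemannian) (hε : -c ≤ ε) : g.HasCurvatureOperatorGe ε :=
  fun _ hcov ↦ (h.with hcov).hasCurvatureOperatorGeWith hg hε

/-- A flat connection has `Rm(φ, φ) = 0 ≥ 0` for every `φ`. [folklore] -/
theorem _root_.Literature.Geometry.Lorentzian.PseudoRiemannianMetric.hasCurvatureOperatorGeWith_zero_of_isFlat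
    (h : cov.IsFlat) : g.HasCurvatureOperatorGeWith cov 0 := fun x _ X Y ↦ by
  rw [g.curvatureOperatorForm_eq_zero_of_isFlat h x X Y]
  simp

/-! ### Scaling -/

/-- `|φ|²_{c g} = c² |φ|²_g`. [folklore] -/
theorem _root_.Literature.Geometry.Lorentzian.PseudoRiemannianMetric.bivectorNormSq_constSmul
    (c : ℝ) (hc : c ≠ 0) (x : M) {m : ℕ} (X Y : Fin m → TangentSpace I x) :
    (g.constSmul c hc).bivectorNormSq x X Y = c ^ 2 * g.bivectorNormSq x X Y := by
  simp only [bivectorNormSq, constSmul_apply, Finset.mul_sum]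
  exact Finset.sum_congr rfl fun a _ ↦ Finset.sum_congr rfl fun a' _ ↦ by ring

/-- `Rm_{c g}(φ, φ) = c Rm_g(φ, φ)` for a fixed connection (the Levi-Civita connection does not
change under constant rescaling, `isLeviCivita_constSmul_iff`). [cite: Topping2006, §1.2.3] -/
theorem _root_.Literature.Geometry.Lorentzian.PseudoRiemannianMetric.curvatureOperatorForm_constSmul
    (c : ℝ) (hc : c ≠ 0) (x : M) {m : ℕ} (X Y : Fin m → TangentSpace I x) :
    (g.constSmul c hc).curvatureOperatorForm cov x X Y = c * g.curvatureOperatorForm cov x X Y := by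
  simp only [curvatureOperatorForm, curvatureForm_constSmul, Finset.mul_sum]

/-- **Scaling of the lower curvature bound** (pair form): `Rm_g ≥ −ε ⇒ Rm_{c g} ≥ −ε/c` for
`c > 0` ("these bounds … hold for any metric after rescaling by a sufficiently large factor",
Bamler–Cabezas-Rivas–Wilking, p. 3). [cite: BamlerCabezasrivasWilking2019, §1, p. 3] -/
theorem _root_.Literature.Geometry.Lorentzian.PseudoRiemannianMetric.HasCurvatureOperatorGeWith.constSmul
    {ε : ℝ} (h : g.HasCurvatureOperatorGeWith cov ε) {c : ℝ} (hc : 0 < c) :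
    (g.constSmul c hc.ne').HasCurvatureOperatorGeWith cov (ε / c) := by
  intro x m X Y
  rw [bivectorNormSq_constSmul, curvatureOperatorForm_constSmul]
  have h1 : c * (-ε * g.bivectorNormSq x X Y) ≤ c * g.curvatureOperatorForm cov x X Y :=
    mul_le_mul_of_nonneg_left (h x m X Y) hc.le
  have h2 : -(ε / c) * (c ^ 2 * g.bivectorNormSq x X Y) = c * (-ε * g.bivectorNormSq x X Y) := by
    rw [sq, show -(ε / c) * (c * c * g.bivectorNormSq x X Y) =
      -(ε / c * c) * c * g.bivectorNormSq x X Y by ring, div_mul_cancel₀ ε hc.ne']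
    ring
  rw [h2]
  exact h1

/-- **Scaling of the lower curvature bound**: `Rm_g ≥ −ε ⇒ Rm_{c g} ≥ −ε/c` for `c > 0`.
[cite: BamlerCabezasrivasWilking2019, §1, p. 3] -/
theorem _root_.Literature.Geometry.Lorentzian.PseudoRiemannianMetric.HasCurvatureOperatorGe.constSmul
    [FiniteDimensional ℝ E] [CompleteSpace E] {ε : ℝ} (h : g.HasCurvatureOperatorGe ε) {c : ℝ}
    (hc : 0 < c) : (g.constSmul c hc.ne').HasCurvatureOperatorGe (ε / c) :=
  fun cov hcov ↦ (h cov ((isLeviCivita_constSmul_iff hc.ne').1 hcov)).constSmul hc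

/-- Non-negative curvature operator is scale invariant (`c > 0`). [folklore] -/
theorem _root_.Literature.Geometry.Lorentzian.PseudoRiemannianMetric.HasNonnegativeCurvatureOperator.constSmul
    [FiniteDimensional ℝ E] [CompleteSpace E] (h : g.HasNonnegativeCurvatureOperator) {c : ℝ}
    (hc : 0 < c) : (g.constSmul c hc.ne').HasNonnegativeCurvatureOperator := by
  have := HasCurvatureOperatorGe.constSmul h hc
  rwa [zero_div] at this

/-! ### Dimensions `0` and `1` -/

variable (g cov) in
/-- In dimension `≤ 1` the curvature form vanishes identically: two tangent vectors are
proportional and `R(X, X) = 0`. [folklore] -/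
theorem _root_.Literature.Geometry.Lorentzian.PseudoRiemannianMetric.curvatureForm_eq_zero_of_finrank_le_one
    [FiniteDimensional ℝ E] (hE : finrank ℝ E ≤ 1) (X Y Z W : TangentSpace I x) :
    g.curvatureForm cov x X Y Z W = 0 := by
  haveI : FiniteDimensional ℝ (TangentSpace I x) := ‹FiniteDimensional ℝ E›
  have hE' : finrank ℝ (TangentSpace I x) ≤ 1 := hE
  obtain ⟨v, hv⟩ := finrank_le_one_iff.1 hE'
  obtain ⟨a, rfl⟩ := hv X
  obtain ⟨c, rfl⟩ := hv Y
  simp [curvatureForm, map_smul]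

variable (g cov) in
/-- In dimension `≤ 1`, `Rm(φ, φ) = 0` for every 2-vector. [folklore] -/
theorem _root_.Literature.Geometry.Lorentzian.PseudoRiemannianMetric.curvatureOperatorForm_eq_zero_of_finrank_le_one
    [FiniteDimensional ℝ E] (hE : finrank ℝ E ≤ 1) {m : ℕ} (X Y : Fin m → TangentSpace I x) :
    g.curvatureOperatorForm cov x X Y = 0 :=
  Finset.sum_eq_zero fun _ _ ↦ Finset.sum_eq_zero fun _ _ ↦
    g.curvatureForm_eq_zero_of_finrank_le_one cov hE ..

variable (g cov) in
/-- In dimension `≤ 1` every pair `(g, cov)` has non-negative curvature operator. [folklore] -/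
theorem _root_.Literature.Geometry.Lorentzian.PseudoRiemannianMetric.hasCurvatureOperatorGeWith_zero_of_finrank_le_one
    [FiniteDimensional ℝ E] (hE : finrank ℝ E ≤ 1) : g.HasCurvatureOperatorGeWith cov 0 :=
  fun x _ X Y ↦ by
    rw [g.curvatureOperatorForm_eq_zero_of_finrank_le_one cov hE X Y]
    simp

variable (g) in
/-- In dimension `≤ 1` every metric has non-negative curvature operator. [folklore] -/
theorem _root_.Literature.Geometry.Lorentzian.PseudoRiemannianMetric.hasNonnegativeCurvatureOperator_of_finrank_le_one
    [FiniteDimensional ℝ E] [CompleteSpace E] (hE : finrank ℝ E ≤ 1) :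
    g.HasNonnegativeCurvatureOperator :=
  fun cov _ ↦ g.hasCurvatureOperatorGeWith_zero_of_finrank_le_one cov hE

end Pointwise

/-- **Corollary 3 (case (1)) in dimensions `k ≤ 1`**, proved: there the curvature operator of
every metric vanishes, so `g' = g` works for any `ε` (here `ε = 1`); these are the degenerate
cases of the printed "`n ∈ ℕ`", recorded with exactly the binders of the named fact
`BamlerCabezasRivasWilking2019_cor3_nonnegativeCurvatureOperator`.
[cite: BamlerCabezasrivasWilking2019, Corollary 3 (case (1) of Theorem 2)] -/
theorem BamlerCabezasRivasWilking2019_cor3_nonnegativeCurvatureOperator_of_le_one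
    (k : ℕ) (hk : k ≤ 1) (D v₀ : ℝ) :
    ∃ ε : ℝ, 0 < ε ∧
    ∀ (M : Type) [TopologicalSpace M] [T2Space M] [SecondCountableTopology M] [CompactSpace M]
      [MeasurableSpace M] [BorelSpace M]
      [ChartedSpace (EuclideanSpace ℝ (Fin k)) M] [IsManifold (𝓡 k) ∞ M]
      (g : PseudoRiemannianMetric (𝓡 k) ∞ (EuclideanSpace ℝ (Fin k))
        (TangentSpace (𝓡 k) : M → Type _)),
      g.IsRiemannian →
      (∀ x y : M, g.riemEDist x y ≤ ENNReal.ofReal D) →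
      ENNReal.ofReal v₀ ≤ g.riemVolume Set.univ →
      g.HasCurvatureOperatorGe ε →
        ∃ g' : PseudoRiemannianMetric (𝓡 k) ∞ (EuclideanSpace ℝ (Fin k))
            (TangentSpace (𝓡 k) : M → Type _),
          g'.IsRiemannian ∧ g'.HasNonnegativeCurvatureOperator :=
  ⟨1, one_pos, fun M _ _ _ _ _ _ _ _ g hg _ _ _ ↦
    ⟨g, hg, g.hasNonnegativeCurvatureOperator_of_finrank_le_one
      (by rw [finrank_euclideanSpace_fin]; exact hk)⟩⟩

/-- The named fact, restricted to dimensions `k ≤ 1`, follows (any `D, v₀`).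
[cite: BamlerCabezasrivasWilking2019, Corollary 3 (case (1) of Theorem 2)] -/
theorem BamlerCabezasRivasWilking2019_cor3_nonnegativeCurvatureOperator_of_two_le
    (h2 : ∀ (k : ℕ), 2 ≤ k → ∀ (D v₀ : ℝ), 0 < D → 0 < v₀ → ∃ ε : ℝ, 0 < ε ∧
      ∀ (M : Type) [TopologicalSpace M] [T2Space M] [SecondCountableTopology M] [CompactSpace M]
        [MeasurableSpace M] [BorelSpace M]
        [ChartedSpace (EuclideanSpace ℝ (Fin k)) M] [IsManifold (𝓡 k) ∞ M]
        (g : PseudoRiemannianMetric (𝓡 k) ∞ (EuclideanSpace ℝ (Fin k))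
          (TangentSpace (𝓡 k) : M → Type _)),
        g.IsRiemannian →
        (∀ x y : M, g.riemEDist x y ≤ ENNReal.ofReal D) →
        ENNReal.ofReal v₀ ≤ g.riemVolume Set.univ →
        g.HasCurvatureOperatorGe ε →
          ∃ g' : PseudoRiemannianMetric (𝓡 k) ∞ (EuclideanSpace ℝ (Fin k))
              (TangentSpace (𝓡 k) : M → Type _),
            g'.IsRiemannian ∧ g'.HasNonnegativeCurvatureOperator) :
    BamlerCabezasRivasWilking2019_cor3_nonnegativeCurvatureOperator := by
  intro k D v₀ hD hv₀
  rcases Nat.lt_or_ge k 2 with hk | hk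
  · exact BamlerCabezasRivasWilking2019_cor3_nonnegativeCurvatureOperator_of_le_one k (by omega) D v₀
  · exact h2 k hk D v₀ hD hv₀

/-! ### Reduction to one Levi-Civita connection (`C^n` metrics, `n ≥ 2`) -/

section LeviCivita

variable {E : Type*} [NormedAddCommGroup E] [NormedSpace ℝ E] {H : Type*} [TopologicalSpace H]
  {I : ModelWithCorners ℝ E H} {M : Type*} [TopologicalSpace M] [ChartedSpace H M]
  [IsManifold I ∞ M] {n : ℕ∞ω} [FiniteDimensional ℝ E] [CompleteSpace E]
  {g : PseudoRiemannianMetric I n E (TangentSpace I : M → Type _)}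
  {cov cov' : CovariantDerivative I E (TangentSpace I : M → Type _)}

/-- **`Rm(φ, φ)` is the same for all Levi-Civita connections of `g`** (`C^n` metric, `n ≥ 2`):
both curvature tensors are `g.riemann` (`IsLeviCivita.curvature_eq_riemann`; O'Neill 1983, Ch. 3,
Thm. 3.11 with Lemma 3.35). [cite: ONeill1983, Ch. 3, Thm. 3.11 and Lemma 3.35] -/
theorem _root_.Literature.Geometry.Lorentzian.PseudoRiemannianMetric.IsLeviCivita.curvatureOperatorForm_eq_of_isLeviCivita
    (h : g.IsLeviCivita cov) (h' : g.IsLeviCivita cov') (hn : 2 ≤ n) (x : M) {m : ℕ}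
    (X Y : Fin m → TangentSpace I x) :
    g.curvatureOperatorForm cov x X Y = g.curvatureOperatorForm cov' x X Y := by
  haveI : Fact (1 ≤ n) := ⟨le_trans (by norm_num) hn⟩
  haveI := g.hasLeviCivita
  simp only [curvatureOperatorForm, curvatureForm, h.curvature_eq_riemann hn x,
    h'.curvature_eq_riemann hn x]

/-- **`Rm_g ≥ −ε` may be tested on any one Levi-Civita connection** (`C^n` metric, `n ≥ 2`): the
`∀ cov`-quantified `HasCurvatureOperatorGe` is equivalent to the pair form for a given
torsion-free `g`-compatible `cov`. [cite: ONeill1983, Ch. 3, Thm. 3.11]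
[cite: BamlerCabezasrivasWilking2019, §1 (Theorem 1: Rm ≥ −ε)] -/
theorem _root_.Literature.Geometry.Lorentzian.PseudoRiemannianMetric.hasCurvatureOperatorGe_iff_of_isLeviCivita
    (hcov : g.IsLeviCivita cov) (hn : 2 ≤ n) {ε : ℝ} :
    g.HasCurvatureOperatorGe ε ↔ g.HasCurvatureOperatorGeWith cov ε :=
  ⟨fun h ↦ h cov hcov, fun h cov' hcov' x m X Y ↦ by
    rw [hcov'.curvatureOperatorForm_eq_of_isLeviCivita hcov hn x X Y]
    exact h x m X Y⟩

/-- **`Rm_g ≥ −ε` iff it holds for the canonical Levi-Civita connection `g.leviCivita`**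
(`C^n` metric, `n ≥ 2`; `[g.HasLeviCivita]` is supplied by `g.hasLeviCivita`).
[cite: ONeill1983, Ch. 3, Thm. 3.11] [cite: BamlerCabezasrivasWilking2019, §1 (Theorem 1: Rm ≥ −ε)] -/
theorem _root_.Literature.Geometry.Lorentzian.PseudoRiemannianMetric.hasCurvatureOperatorGe_iff_leviCivita
    [Fact (1 ≤ n)] [g.HasLeviCivita] (hn : 2 ≤ n) {ε : ℝ} :
    g.HasCurvatureOperatorGe ε ↔ g.HasCurvatureOperatorGeWith g.leviCivita ε :=
  hasCurvatureOperatorGe_iff_of_isLeviCivita (isLeviCivita_leviCivita_holds (g := g)) hn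

/-- **Non-negative curvature operator iff `Rm(φ, φ) ≥ 0` for the canonical Levi-Civita
connection** (`C^n` metric, `n ≥ 2`). [cite: Hamilton1986, §1, p. 153]
[cite: ONeill1983, Ch. 3, Thm. 3.11] -/
theorem _root_.Literature.Geometry.Lorentzian.PseudoRiemannianMetric.hasNonnegativeCurvatureOperator_iff_leviCivita
    [Fact (1 ≤ n)] [g.HasLeviCivita] (hn : 2 ≤ n) :
    g.HasNonnegativeCurvatureOperator ↔
      ∀ (x : M) (m : ℕ) (X Y : Fin m → TangentSpace I x),
        0 ≤ g.curvatureOperatorForm g.leviCivita x X Y := by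
  rw [HasNonnegativeCurvatureOperator, hasCurvatureOperatorGe_iff_leviCivita hn,
    hasCurvatureOperatorGeWith_zero_iff]

/-- A metric with non-negative curvature operator for SOME Levi-Civita connection has it for all
(`n ≥ 2`): the pair form implies the metric form. [cite: Hamilton1986, §1, p. 153] -/
theorem _root_.Literature.Geometry.Lorentzian.PseudoRiemannianMetric.HasCurvatureOperatorGeWith.hasCurvatureOperatorGe
    {ε : ℝ} (h : g.HasCurvatureOperatorGeWith cov ε) (hcov : g.IsLeviCivita cov) (hn : 2 ≤ n) :
    g.HasCurvatureOperatorGe ε :=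
  (hasCurvatureOperatorGe_iff_of_isLeviCivita hcov hn).2 h

end LeviCivita

/-! ### Composition with Hamilton 1986, Thm. 1.3 (both named facts as hypotheses) -/

namespace BamlerCabezasRivasWilking2019_cor3_nonnegativeCurvatureOperator

/-- **Almost non-negatively curved, non-collapsed, simply connected closed 4-manifolds**
(Corollary 3 (1) of Bamler–Cabezas-Rivas–Wilking composed with Hamilton 1986, Thm. 1.3 (a); both
named facts as hypotheses): given `D, v₀ > 0` there is `ε = ε(D, v₀) > 0` such that every closed
simply connected smooth 4-manifold with a Riemannian metric of `diam ≤ D`, `vol ≥ v₀` and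
`Rm ≥ −ε` is diffeomorphic to `S⁴`, to `ℂℙ²` or to `S² × S²`.
[cite: BamlerCabezasrivasWilking2019, Corollary 3 (case (1))] [cite: Hamilton1986, §1, Thm. 1.3 (p. 154)] -/
theorem simplyConnected_four (h : BamlerCabezasRivasWilking2019_cor3_nonnegativeCurvatureOperator)
    (hH : hamilton1986_nonnegCurvatureOperator_four) (D v₀ : ℝ) (hD : 0 < D) (hv₀ : 0 < v₀) :
    ∃ ε : ℝ, 0 < ε ∧
    ∀ (M : Type) [TopologicalSpace M] [T2Space M] [SecondCountableTopology M] [CompactSpace M]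
      [MeasurableSpace M] [BorelSpace M]
      [ChartedSpace (EuclideanSpace ℝ (Fin 4)) M] [IsManifold (𝓡 4) ∞ M] [SimplyConnectedSpace M]
      (g : PseudoRiemannianMetric (𝓡 4) ∞ (EuclideanSpace ℝ (Fin 4))
        (TangentSpace (𝓡 4) : M → Type _)),
      g.IsRiemannian →
      (∀ x y : M, g.riemEDist x y ≤ ENNReal.ofReal D) →
      ENNReal.ofReal v₀ ≤ g.riemVolume Set.univ →
      g.HasCurvatureOperatorGe ε →
        Nonempty (M ≃ₘ⟮𝓡 4, 𝓡 4⟯ (Metric.sphere (0 : EuclideanSpace ℝ (Fin 5)) 1)) ∨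
          Nonempty (M ≃ₘ⟮𝓡 4, 𝓡 4⟯ Literature.Topology.FourManifolds.ComplexProjectivePlane) ∨
            Nonempty (M ≃ₘ⟮𝓡 4, (𝓡 2).prod (𝓡 2)⟯ ((Metric.sphere (0 : EuclideanSpace ℝ (Fin 3)) 1) × (Metric.sphere (0 : EuclideanSpace ℝ (Fin 3)) 1))) := by
  obtain ⟨ε, hε, hM⟩ := h 4 D v₀ hD hv₀
  refine ⟨ε, hε, fun M _ _ _ _ _ _ _ _ _ g hg hdiam hvol hRm ↦ ?_⟩
  exact hH.simplyConnected M (hM M g hg hdiam hvol hRm)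

/-- **Almost non-negatively curved, non-collapsed homotopy 4-spheres are standard** (Corollary 3
(1) of Bamler–Cabezas-Rivas–Wilking composed with Hamilton 1986, Thm. 1.3 (b); both named facts as
hypotheses — the `BCRWUpgrade` shape of the `SmoothPoincare4` route): given `D, v₀ > 0` there is
`ε = ε(D, v₀) > 0` such that every closed simply connected smooth 4-manifold homotopy equivalent to
`S⁴` carrying a Riemannian metric with `diam ≤ D`, `vol ≥ v₀`, `Rm ≥ −ε` is diffeomorphic to `S⁴`.
[cite: BamlerCabezasrivasWilking2019, Corollary 3 (case (1))] [cite: Hamilton1986, §1, Thm. 1.3 (p. 154)] -/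
theorem sphere_of_homotopyEquiv_four
    (h : BamlerCabezasRivasWilking2019_cor3_nonnegativeCurvatureOperator)
    (hH : hamilton1986_nonnegCurvatureOperator_four) (D v₀ : ℝ) (hD : 0 < D) (hv₀ : 0 < v₀) :
    ∃ ε : ℝ, 0 < ε ∧
    ∀ (M : Type) [TopologicalSpace M] [T2Space M] [SecondCountableTopology M] [CompactSpace M]
      [MeasurableSpace M] [BorelSpace M]
      [ChartedSpace (EuclideanSpace ℝ (Fin 4)) M] [IsManifold (𝓡 4) ∞ M] [SimplyConnectedSpace M],
      Nonempty (ContinuousMap.HomotopyEquiv M (Metric.sphere (0 : EuclideanSpace ℝ (Fin 5)) 1)) →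
      ∀ (g : PseudoRiemannianMetric (𝓡 4) ∞ (EuclideanSpace ℝ (Fin 4))
        (TangentSpace (𝓡 4) : M → Type _)),
      g.IsRiemannian →
      (∀ x y : M, g.riemEDist x y ≤ ENNReal.ofReal D) →
      ENNReal.ofReal v₀ ≤ g.riemVolume Set.univ →
      g.HasCurvatureOperatorGe ε →
        Nonempty (M ≃ₘ⟮𝓡 4, 𝓡 4⟯ (Metric.sphere (0 : EuclideanSpace ℝ (Fin 5)) 1)) := by
  obtain ⟨ε, hε, hM⟩ := h 4 D v₀ hD hv₀
  refine ⟨ε, hε, fun M _ _ _ _ _ _ _ _ _ he g hg hdiam hvol hRm ↦ ?_⟩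
  exact hH.sphere_of_homotopyEquiv M he (hM M g hg hdiam hvol hRm)

end BamlerCabezasRivasWilking2019_cor3_nonnegativeCurvatureOperator

/-! ### Consequences of `Rm ≥ −ε`: sectional, Ricci and scalar curvature lower bounds -/

section Consequences

variable {E : Type*} [NormedAddCommGroup E] [NormedSpace ℝ E] {H : Type*} [TopologicalSpace H]
  {I : ModelWithCorners ℝ E H} {M : Type*} [TopologicalSpace M] [ChartedSpace H M]
  [IsManifold I ∞ M] {n : ℕ∞ω}
  {g : PseudoRiemannianMetric I n E (TangentSpace I : M → Type _)}
  {cov : CovariantDerivative I E (TangentSpace I : M → Type _)}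

/-- **`Rm ≥ −ε` on a single pair**: `−ε (g(X,X) g(Y,Y) − g(X,Y)²) ≤ Rm(X, Y, Y, X)` — the case
`φ = X ∧ Y` of the definition (`|X ∧ Y|² = g(X,X) g(Y,Y) − g(X,Y)²`).
[cite: BamlerCabezasrivasWilking2019, §1 (Theorem 1: Rm ≥ −ε)] -/
theorem _root_.Literature.Geometry.Lorentzian.PseudoRiemannianMetric.HasCurvatureOperatorGeWith.curvatureForm_pair_ge
    {ε : ℝ} (h : g.HasCurvatureOperatorGeWith cov ε) (x : M) (X Y : TangentSpace I x) :
    -ε * (g.val x X X * g.val x Y Y - g.val x X Y ^ 2) ≤ g.curvatureForm cov x X Y Y X := by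
  have h1 := h x 1 (fun _ ↦ X) (fun _ ↦ Y)
  simp only [bivectorNormSq_one, curvatureOperatorForm_one] at h1
  rw [g.symm x Y X] at h1
  rw [sq]
  exact h1

/-- **`Rm ≥ −ε` implies sectional curvature `≥ −ε`**: for a `g_x`-orthonormal pair `X, Y`,
`−ε ≤ K(X, Y)`. [cite: BamlerCabezasrivasWilking2019, §1 (Theorem 1: Rm ≥ −ε)] -/
theorem _root_.Literature.Geometry.Lorentzian.PseudoRiemannianMetric.HasCurvatureOperatorGeWith.sectionalCurvature_ge
    {ε : ℝ} (h : g.HasCurvatureOperatorGeWith cov ε) (x : M) {X Y : TangentSpace I x}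
    (hX : g.val x X X = 1) (hY : g.val x Y Y = 1) (hXY : g.val x X Y = 0) :
    -ε ≤ g.sectionalCurvature cov x X Y := by
  rw [sectionalCurvature_of_orthonormal g cov x hX hY hXY]
  have h1 := h.curvatureForm_pair_ge x X Y
  rw [hX, hY, hXY] at h1
  simpa using h1

/-- **`Rm ≥ −ε` implies `Ric ≥ −(n − 1) ε g`** (positive definite `g_x`, `n = dim M`): for every
`X`, `−(n − 1) ε g(X, X) ≤ Ric(X, X)`; in an orthonormal basis `Ric(X, X) = Σ_m Rm(b_m, X, X, b_m)`
and `Σ_m (g(X,X) − g(b_m, X)²) = (n − 1) g(X, X)` (Parseval). This is the Ricci lower bound under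
which Bishop–Gromov volume comparison is applied in the printed proof.
[cite: BamlerCabezasrivasWilking2019, §1 (Theorem 1) and §4] -/
theorem _root_.Literature.Geometry.Lorentzian.PseudoRiemannianMetric.HasCurvatureOperatorGeWith.ricci_ge
    [FiniteDimensional ℝ E] {ε : ℝ} (h : g.HasCurvatureOperatorGeWith cov ε) (x : M)
    (hpos : ∀ v : TangentSpace I x, v ≠ 0 → 0 < g.val x v v) (X : TangentSpace I x) :
    -((finrank ℝ E - 1 : ℝ) * ε) * g.val x X X ≤ cov.ricci x X X := by
  obtain ⟨b, hb⟩ := g.exists_basis_isOrthonormalFrame hpos rfl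
  rw [g.ricci_eq_sum_of_isOrthonormalFrame b hb cov X X]
  have hterm : ∀ m, -ε * (g.val x X X - g.val x (b m) X ^ 2) ≤
      g.curvatureForm cov x (b m) X X (b m) := by
    intro m
    have h1 := h.curvatureForm_pair_ge x (b m) X
    rwa [hb.1 m, one_mul] at h1
  have hsum : ∑ m, -ε * (g.val x X X - g.val x (b m) X ^ 2) ≤
      ∑ m, g.curvatureForm cov x (b m) X X (b m) :=
    Finset.sum_le_sum fun m _ ↦ hterm m
  have hsq : ∑ m, g.val x (b m) X ^ 2 = g.val x X X := by
    rw [g.val_eq_sum_of_isOrthonormalFrame b hb X X]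
    exact Finset.sum_congr rfl fun m _ ↦ by rw [g.symm x (b m) X, sq]
  have hlhs : ∑ m, -ε * (g.val x X X - g.val x (b m) X ^ 2) =
      -((finrank ℝ E - 1 : ℝ) * ε) * g.val x X X := by
    rw [← Finset.mul_sum, Finset.sum_sub_distrib, hsq, Finset.sum_const, Finset.card_univ,
      Fintype.card_fin, nsmul_eq_mul]
    ring
  rw [← hlhs]
  exact hsum

/-- **`Rm ≥ −ε` implies `R ≥ −n(n − 1) ε`** (positive definite `g_x`, `n = dim M`): the scalar
curvature of the pair `(g, cov)` is `Σ_i Ric(b_i, b_i)` in an orthonormal basis.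
[cite: BamlerCabezasrivasWilking2019, §1 (Theorem 1) and §4] -/
theorem _root_.Literature.Geometry.Lorentzian.PseudoRiemannianMetric.HasCurvatureOperatorGeWith.scalarCurvatureWith_ge
    [FiniteDimensional ℝ E] {ε : ℝ} (h : g.HasCurvatureOperatorGeWith cov ε) (x : M)
    (hpos : ∀ v : TangentSpace I x, v ≠ 0 → 0 < g.val x v v) :
    -((finrank ℝ E : ℝ) * (finrank ℝ E - 1) * ε) ≤ g.scalarCurvatureWith cov x := by
  obtain ⟨b, hb⟩ := g.exists_basis_isOrthonormalFrame hpos rfl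
  rw [scalarCurvatureWith, g.trace_eq_sum_of_isOrthonormalFrame b hb]
  have hterm : ∀ i, -((finrank ℝ E - 1 : ℝ) * ε) ≤ cov.ricci x (b i) (b i) := by
    intro i
    have h1 := h.ricci_ge x hpos (b i)
    rwa [hb.1 i, mul_one] at h1
  have hsum : ∑ _i : Fin (finrank ℝ E), -((finrank ℝ E - 1 : ℝ) * ε) ≤
      ∑ i, cov.ricci x (b i) (b i) :=
    Finset.sum_le_sum fun i _ ↦ hterm i
  have hlhs : ∑ _i : Fin (finrank ℝ E), -((finrank ℝ E - 1 : ℝ) * ε) =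
      -((finrank ℝ E : ℝ) * (finrank ℝ E - 1) * ε) := by
    rw [Finset.sum_const, Finset.card_univ, Fintype.card_fin, nsmul_eq_mul]
    ring
  rw [← hlhs]
  exact hsum

/-- `Rm_g ≥ −ε` (Riemannian `g`, any Levi-Civita `cov`) gives `Ric ≥ −(n − 1) ε g`.
[cite: BamlerCabezasrivasWilking2019, §1 (Theorem 1) and §4] -/
theorem _root_.Literature.Geometry.Lorentzian.PseudoRiemannianMetric.HasCurvatureOperatorGe.ricci_ge
    [FiniteDimensional ℝ E] [CompleteSpace E] {ε : ℝ} (h : g.HasCurvatureOperatorGe ε)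
    (hg : g.IsRiemannian) (hcov : g.IsLeviCivita cov) (x : M) (X : TangentSpace I x) :
    -((finrank ℝ E - 1 : ℝ) * ε) * g.val x X X ≤ cov.ricci x X X :=
  (h cov hcov).ricci_ge x (fun v hv ↦ hg x v hv) X

/-- `Rm_g ≥ −ε` (Riemannian `g`, any Levi-Civita `cov`) gives `R ≥ −n(n − 1) ε`.
[cite: BamlerCabezasrivasWilking2019, §1 (Theorem 1) and §4] -/
theorem _root_.Literature.Geometry.Lorentzian.PseudoRiemannianMetric.HasCurvatureOperatorGe.scalarCurvatureWith_ge
    [FiniteDimensional ℝ E] [CompleteSpace E] {ε : ℝ} (h : g.HasCurvatureOperatorGe ε)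
    (hg : g.IsRiemannian) (hcov : g.IsLeviCivita cov) (x : M) :
    -((finrank ℝ E : ℝ) * (finrank ℝ E - 1) * ε) ≤ g.scalarCurvatureWith cov x :=
  (h cov hcov).scalarCurvatureWith_ge x fun v hv ↦ hg x v hv

/-- **Non-negative curvature operator implies `Ric ≥ 0`** (Riemannian `g`, any Levi-Civita
`cov`). [cite: Hamilton1986, §1, p. 153] -/
theorem _root_.Literature.Geometry.Lorentzian.PseudoRiemannianMetric.HasNonnegativeCurvatureOperator.ricci_nonneg
    [FiniteDimensional ℝ E] [CompleteSpace E] (h : g.HasNonnegativeCurvatureOperator)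
    (hg : g.IsRiemannian) (hcov : g.IsLeviCivita cov) (x : M) (X : TangentSpace I x) :
    0 ≤ cov.ricci x X X := by
  have h1 := HasCurvatureOperatorGe.ricci_ge h hg hcov x X
  simpa using h1

/-- **Non-negative curvature operator implies `R ≥ 0`** (Riemannian `g`, any Levi-Civita `cov`).
[cite: Hamilton1986, §1, p. 153] -/
theorem _root_.Literature.Geometry.Lorentzian.PseudoRiemannianMetric.HasNonnegativeCurvatureOperator.scalarCurvatureWith_nonneg
    [FiniteDimensional ℝ E] [CompleteSpace E] (h : g.HasNonnegativeCurvatureOperator)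
    (hg : g.IsRiemannian) (hcov : g.IsLeviCivita cov) (x : M) :
    0 ≤ g.scalarCurvatureWith cov x := by
  have h1 := HasCurvatureOperatorGe.scalarCurvatureWith_ge h hg hcov x
  simpa using h1

end Consequences

/-! ### Lower curvature bounds pass to pointwise limits -/

section Limits

open Filter

variable {E : Type*} [NormedAddCommGroup E] [NormedSpace ℝ E] {H : Type*} [TopologicalSpace H]
  {I : ModelWithCorners ℝ E H} {M : Type*} [TopologicalSpace M] [ChartedSpace H M]
  [IsManifold I ∞ M] {n : ℕ∞ω}
  {g : PseudoRiemannianMetric I n E (TangentSpace I : M → Type _)}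
  {cov : CovariantDerivative I E (TangentSpace I : M → Type _)}

/-- **Lower curvature bounds pass to pointwise limits** ("By definition of Cheeger–Gromov
convergence the curvature condition … passes to the limit", p. 15, on a fixed manifold, i.e. after
pulling back by the diffeomorphisms): if pairs `(gᵢ, covᵢ)` satisfy `Rm ≥ −δᵢ` with `δᵢ → δ` along
a non-trivial filter, and at every point and every finite family of pairs the curvature operator
forms and the squared norms of `(gᵢ, covᵢ)` converge to those of `(g, cov)`, then `(g, cov)`
satisfies `Rm ≥ −δ`. [cite: BamlerCabezasrivasWilking2019, proof of Corollary 3 (p. 15)] -/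
theorem _root_.Literature.Geometry.Lorentzian.PseudoRiemannianMetric.hasCurvatureOperatorGeWith_of_tendsto
    {ι : Type*} {l : Filter ι} [l.NeBot]
    {gs : ι → PseudoRiemannianMetric I n E (TangentSpace I : M → Type _)}
    {covs : ι → CovariantDerivative I E (TangentSpace I : M → Type _)} {δ : ι → ℝ} {δ₀ : ℝ}
    (hδ : Tendsto δ l (𝓝 δ₀))
    (h : ∀ i, (gs i).HasCurvatureOperatorGeWith (covs i) (δ i))
    (hRm : ∀ (x : M) (m : ℕ) (X Y : Fin m → TangentSpace I x),
      Tendsto (fun i ↦ (gs i).curvatureOperatorForm (covs i) x X Y) l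
        (𝓝 (g.curvatureOperatorForm cov x X Y)))
    (hN : ∀ (x : M) (m : ℕ) (X Y : Fin m → TangentSpace I x),
      Tendsto (fun i ↦ (gs i).bivectorNormSq x X Y) l (𝓝 (g.bivectorNormSq x X Y))) :
    g.HasCurvatureOperatorGeWith cov δ₀ := by
  intro x m X Y
  have h1 : Tendsto (fun i ↦ -(δ i) * (gs i).bivectorNormSq x X Y) l
      (𝓝 (-δ₀ * g.bivectorNormSq x X Y)) :=
    hδ.neg.mul (hN x m X Y)
  exact le_of_tendsto_of_tendsto h1 (hRm x m X Y) (Eventually.of_forall fun i ↦ h i x m X Y)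

/-- In particular `Rm ≥ −δᵢ` with `δᵢ → 0` gives `Rm ≥ 0` in the pointwise limit.
[cite: BamlerCabezasrivasWilking2019, proof of Corollary 3 (p. 15)] -/
theorem _root_.Literature.Geometry.Lorentzian.PseudoRiemannianMetric.hasCurvatureOperatorGeWith_zero_of_tendsto
    {ι : Type*} {l : Filter ι} [l.NeBot]
    {gs : ι → PseudoRiemannianMetric I n E (TangentSpace I : M → Type _)}
    {covs : ι → CovariantDerivative I E (TangentSpace I : M → Type _)} {δ : ι → ℝ}
    (hδ : Tendsto δ l (𝓝 0))
    (h : ∀ i, (gs i).HasCurvatureOperatorGeWith (covs i) (δ i))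
    (hRm : ∀ (x : M) (m : ℕ) (X Y : Fin m → TangentSpace I x),
      Tendsto (fun i ↦ (gs i).curvatureOperatorForm (covs i) x X Y) l
        (𝓝 (g.curvatureOperatorForm cov x X Y)))
    (hN : ∀ (x : M) (m : ℕ) (X Y : Fin m → TangentSpace I x),
      Tendsto (fun i ↦ (gs i).bivectorNormSq x X Y) l (𝓝 (g.bivectorNormSq x X Y))) :
    g.HasCurvatureOperatorGeWith cov 0 :=
  hasCurvatureOperatorGeWith_of_tendsto hδ h hRm hN

end Limits

/-! ### The sequential (contradiction) form of Corollary 3 (1) -/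

/-- **Corollary 3 (1) is equivalent to its sequential form** — the first step of the printed proof
(p. 15: "We argue by contradiction: If the statement was false, then we can find a sequence of
counterexamples, that is, a sequence of closed Riemannian `n`-dimensional manifolds `{(Mᵢ, gᵢ)}`
satisfying `vol_{gᵢ}(Mᵢ) ≥ v₀`, `Rm_{gᵢ} + (1/i) I ∈ 𝒞` and `diam_{gᵢ}(Mᵢ) ≤ D`, so that each `Mᵢ`
admits no metric `ḡᵢ` with `Rm_{ḡᵢ} ∈ 𝒞`"): the named fact holds iff for every `k, D, v₀ > 0` and
every sequence of closed smooth `k`-manifolds `(Mᵢ, gᵢ)` with `diam ≤ D`, `vol ≥ v₀` and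
`Rm_{gᵢ} ≥ −1/(i+1)`, some `Mᵢ` admits a smooth Riemannian metric with non-negative curvature
operator.  (`⇒`: take `i` with `1/(i+1) ≤ ε` and the monotonicity in `ε`; `⇐`: choice of a
counterexample for each `ε = 1/(i+1)`.)  The remaining content of the printed proof — Theorem 1,
Hamilton's compactness theorem and the Cheeger–Gromov diffeomorphisms `M_∞ ≅ Mᵢ` — is exactly
what produces such an `i`. [cite: BamlerCabezasrivasWilking2019, proof of Corollary 3 (p. 15)] -/
theorem BamlerCabezasRivasWilking2019_cor3_nonnegativeCurvatureOperator_iff_seq :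
    BamlerCabezasRivasWilking2019_cor3_nonnegativeCurvatureOperator ↔
    ∀ (k : ℕ) (D v₀ : ℝ), 0 < D → 0 < v₀ →
      ∀ (M : ℕ → Type) [∀ i, TopologicalSpace (M i)] [∀ i, T2Space (M i)]
        [∀ i, SecondCountableTopology (M i)] [∀ i, CompactSpace (M i)]
        [∀ i, MeasurableSpace (M i)] [∀ i, BorelSpace (M i)]
        [∀ i, ChartedSpace (EuclideanSpace ℝ (Fin k)) (M i)] [∀ i, IsManifold (𝓡 k) ∞ (M i)]
        (g : ∀ i, PseudoRiemannianMetric (𝓡 k) ∞ (EuclideanSpace ℝ (Fin k))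
          (TangentSpace (𝓡 k) : M i → Type _)),
        (∀ i, (g i).IsRiemannian) →
        (∀ i (x y : M i), (g i).riemEDist x y ≤ ENNReal.ofReal D) →
        (∀ i, ENNReal.ofReal v₀ ≤ (g i).riemVolume Set.univ) →
        (∀ i, (g i).HasCurvatureOperatorGe (1 / ((i : ℝ) + 1))) →
          ∃ (i : ℕ) (g' : PseudoRiemannianMetric (𝓡 k) ∞ (EuclideanSpace ℝ (Fin k))
              (TangentSpace (𝓡 k) : M i → Type _)),
            g'.IsRiemannian ∧ g'.HasNonnegativeCurvatureOperator := by
  constructor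
  · intro h k D v₀ hD hv₀ M _ _ _ _ _ _ _ _ g hg hdiam hvol hRm
    obtain ⟨ε, hε, hM⟩ := h k D v₀ hD hv₀
    obtain ⟨i, hi⟩ := exists_nat_one_div_lt hε
    exact ⟨i, hM (M i) (g i) (hg i) (hdiam i) (hvol i) ((hRm i).mono (hg i) hi.le)⟩
  · intro H k D v₀ hD hv₀
    by_contra hneg
    -- a counterexample for each `ε = 1/(i+1)`
    have hex : ∀ i : ℕ, ∃ (M : Type) (_ : TopologicalSpace M) (_ : T2Space M)
        (_ : SecondCountableTopology M) (_ : CompactSpace M) (_ : MeasurableSpace M)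
        (_ : BorelSpace M) (_ : ChartedSpace (EuclideanSpace ℝ (Fin k)) M)
        (_ : IsManifold (𝓡 k) ∞ M)
        (g : PseudoRiemannianMetric (𝓡 k) ∞ (EuclideanSpace ℝ (Fin k))
          (TangentSpace (𝓡 k) : M → Type _)),
        g.IsRiemannian ∧ (∀ x y : M, g.riemEDist x y ≤ ENNReal.ofReal D) ∧
          ENNReal.ofReal v₀ ≤ g.riemVolume Set.univ ∧
          g.HasCurvatureOperatorGe (1 / ((i : ℝ) + 1)) ∧
          ∀ g' : PseudoRiemannianMetric (𝓡 k) ∞ (EuclideanSpace ℝ (Fin k))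
              (TangentSpace (𝓡 k) : M → Type _),
            g'.IsRiemannian → ¬ g'.HasNonnegativeCurvatureOperator := by
      intro i
      by_contra hall
      apply hneg
      refine ⟨1 / ((i : ℝ) + 1), by positivity, fun M _ _ _ _ _ _ _ _ g hg hdiam hvol hRm ↦ ?_⟩
      by_contra hno
      apply hall
      exact ⟨M, inferInstance, inferInstance, inferInstance, inferInstance, inferInstance,
        inferInstance, inferInstance, inferInstance, g, hg, hdiam, hvol, hRm,
        fun g' hg' hN ↦ hno ⟨g', hg', hN⟩⟩
    choose M iT iT2 iSC iC iMS iB iCh iMan g hg hdiam hvol hRm hno using hex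
    obtain ⟨i, g', hg', hN⟩ := @H k D v₀ hD hv₀ M iT iT2 iSC iC iMS iB iCh iMan g hg hdiam hvol hRm
    exact hno i g' hg' hN

/-! ### Transport along local diffeomorphisms (step 5 of the printed proof) -/

section Transport

variable {E : Type*} [NormedAddCommGroup E] [NormedSpace ℝ E] {H : Type*} [TopologicalSpace H]
  {I : ModelWithCorners ℝ E H} {M : Type*} [TopologicalSpace M] [ChartedSpace H M]
  [IsManifold I ∞ M]
  {E' : Type*} [NormedAddCommGroup E'] [NormedSpace ℝ E'] {H' : Type*} [TopologicalSpace H']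
  {I' : ModelWithCorners ℝ E' H'} {N : Type*} [TopologicalSpace N] [ChartedSpace H' N]
  [IsManifold I' ∞ N]
  [FiniteDimensional ℝ E] [FiniteDimensional ℝ E'] [CompleteSpace E] [CompleteSpace E']
  (g : PseudoRiemannianMetric I ∞ E (TangentSpace I : M → Type _))
  {Φ : N → M} (hpb : contMDiff_pullbackBilin I M I' N ∞) (hΦ : ContMDiff I' I (∞ + 1) Φ)
  (hΦ' : ∀ u, Function.Injective (mfderiv I' I Φ u))
  (hdim : Module.finrank ℝ E' = Module.finrank ℝ E)

omit [CompleteSpace E] [CompleteSpace E'] in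
/-- `|φ|²_{Φ^*g} = |dΦ φ|²_g`: the squared norm of a 2-vector for the pullback metric.
[cite: ONeill1983, Ch. 3, Def. 3.9] -/
theorem _root_.Literature.Geometry.Lorentzian.PseudoRiemannianMetric.bivectorNormSq_comap
    (u : N) {m : ℕ} (X Y : Fin m → TangentSpace I' u) :
    (g.comap hpb Φ hΦ hΦ' hdim).bivectorNormSq u X Y =
      g.bivectorNormSq (Φ u) (fun a ↦ mfderiv I' I Φ u (X a)) (fun a ↦ mfderiv I' I Φ u (Y a)) := by
  simp [bivectorNormSq, Literature.Geometry.Lorentzian.pullbackBilin_apply]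

/-- **Naturality of the curvature form**: `Rm^{Φ^*g}(X, Y, Z, W) = Rm^g(dΦ X, dΦ Y, dΦ Z, dΦ W)`
for the Levi-Civita connections (O'Neill 1983, Ch. 3, Prop. 3.59, "isometries preserve
curvature", through `riemann_comap_apply`). [cite: ONeill1983, Ch. 3, Prop. 3.59] -/
theorem _root_.Literature.Geometry.Lorentzian.PseudoRiemannianMetric.curvatureForm_comap_leviCivita
    [g.HasLeviCivita] [(g.comap hpb Φ hΦ hΦ' hdim).HasLeviCivita]
    (u : N) (X₀ Y₀ Z₀ W₀ : TangentSpace I' u) :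
    (g.comap hpb Φ hΦ hΦ' hdim).curvatureForm (g.comap hpb Φ hΦ hΦ' hdim).leviCivita u X₀ Y₀ Z₀ W₀ =
      g.curvatureForm g.leviCivita (Φ u) (mfderiv I' I Φ u X₀) (mfderiv I' I Φ u Y₀)
        (mfderiv I' I Φ u Z₀) (mfderiv I' I Φ u W₀) := by
  change (g.comap hpb Φ hΦ hΦ' hdim).val u ((g.comap hpb Φ hΦ hΦ' hdim).riemann u X₀ Y₀ Z₀) W₀ =
    g.val (Φ u) (g.riemann (Φ u) (mfderiv I' I Φ u X₀) (mfderiv I' I Φ u Y₀)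
      (mfderiv I' I Φ u Z₀)) (mfderiv I' I Φ u W₀)
  rw [g.riemann_comap_apply hpb hΦ hΦ' hdim u X₀ Y₀ Z₀, val_comap, Literature.Geometry.Lorentzian.pullbackBilin_apply,
    inverse_mfderiv_apply hdim (hΦ' u), Literature.Geometry.Lorentzian.mfderiv_mfderivEquivOfInjective_symm]

/-- `Rm^{Φ^*g}(φ, φ) = Rm^g(dΦ φ, dΦ φ)` for the Levi-Civita connections.
[cite: ONeill1983, Ch. 3, Prop. 3.59] -/
theorem _root_.Literature.Geometry.Lorentzian.PseudoRiemannianMetric.curvatureOperatorForm_comap_leviCivita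
    [g.HasLeviCivita] [(g.comap hpb Φ hΦ hΦ' hdim).HasLeviCivita]
    (u : N) {m : ℕ} (X Y : Fin m → TangentSpace I' u) :
    (g.comap hpb Φ hΦ hΦ' hdim).curvatureOperatorForm (g.comap hpb Φ hΦ hΦ' hdim).leviCivita u X Y =
      g.curvatureOperatorForm g.leviCivita (Φ u) (fun a ↦ mfderiv I' I Φ u (X a))
        (fun a ↦ mfderiv I' I Φ u (Y a)) := by
  simp only [curvatureOperatorForm, g.curvatureForm_comap_leviCivita hpb hΦ hΦ' hdim]

variable {g} in
/-- **`Rm_g ≥ −ε ⇒ Rm_{Φ^*g} ≥ −ε`** for the Levi-Civita connections (pair form).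
[cite: ONeill1983, Ch. 3, Prop. 3.59] [cite: BamlerCabezasrivasWilking2019, proof of Corollary 3 (p. 15)] -/
theorem _root_.Literature.Geometry.Lorentzian.PseudoRiemannianMetric.HasCurvatureOperatorGeWith.comap_leviCivita
    [g.HasLeviCivita] [(g.comap hpb Φ hΦ hΦ' hdim).HasLeviCivita] {ε : ℝ}
    (h : g.HasCurvatureOperatorGeWith g.leviCivita ε) :
    (g.comap hpb Φ hΦ hΦ' hdim).HasCurvatureOperatorGeWith (g.comap hpb Φ hΦ hΦ' hdim).leviCivita ε :=
  fun u m X Y ↦ by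
    rw [bivectorNormSq_comap g hpb hΦ hΦ' hdim, curvatureOperatorForm_comap_leviCivita g hpb hΦ hΦ' hdim]
    exact h (Φ u) m _ _

variable {g} in
/-- **`Rm_g ≥ −ε ⇒ Rm_{Φ^*g} ≥ −ε`** along a smooth equidimensional immersion `Φ` (metric
form, over all Levi-Civita connections). [cite: ONeill1983, Ch. 3, Prop. 3.59]
[cite: BamlerCabezasrivasWilking2019, proof of Corollary 3 (p. 15)] -/
theorem _root_.Literature.Geometry.Lorentzian.PseudoRiemannianMetric.HasCurvatureOperatorGe.comap
    {ε : ℝ} (h : g.HasCurvatureOperatorGe ε) :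
    (g.comap hpb Φ hΦ hΦ' hdim).HasCurvatureOperatorGe ε := by
  haveI := g.hasLeviCivita
  haveI := (g.comap hpb Φ hΦ hΦ' hdim).hasLeviCivita
  have h2 : (2 : ℕ∞ω) ≤ ∞ := WithTop.coe_le_coe.mpr le_top
  rw [hasCurvatureOperatorGe_iff_leviCivita h2] at h ⊢
  exact h.comap_leviCivita hpb hΦ hΦ' hdim

variable {g} in
omit [CompleteSpace E] [CompleteSpace E'] in
/-- The pullback of a Riemannian metric along an immersion is Riemannian. [cite: ONeill1983, Ch. 3, p. 90] -/
theorem _root_.Literature.Geometry.Lorentzian.PseudoRiemannianMetric.IsRiemannian.comap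
    (hg : g.IsRiemannian) : (g.comap hpb Φ hΦ hΦ' hdim).IsRiemannian := fun u v hv ↦ by
  simp only [val_comap, Literature.Geometry.Lorentzian.pullbackBilin_apply]
  exact hg (Φ u) _ fun h0 ↦ hv (hΦ' u (by rw [map_zero]; exact h0))

variable {g} in
/-- **`Rm ≥ 0` is transported along smooth equidimensional immersions** (in particular along
diffeomorphisms). [cite: ONeill1983, Ch. 3, Prop. 3.59] [cite: BamlerCabezasrivasWilking2019, proof of Corollary 3 (p. 15)] -/
theorem _root_.Literature.Geometry.Lorentzian.PseudoRiemannianMetric.HasNonnegativeCurvatureOperator.comap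
    (h : g.HasNonnegativeCurvatureOperator) :
    (g.comap hpb Φ hΦ hΦ' hdim).HasNonnegativeCurvatureOperator :=
  HasCurvatureOperatorGe.comap hpb hΦ hΦ' hdim h

omit [IsManifold I ∞ M] [IsManifold I' ∞ N] [FiniteDimensional ℝ E] [FiniteDimensional ℝ E']
  [CompleteSpace E] [CompleteSpace E'] in
/-- The differential of a diffeomorphism is injective (chain rule on `Φ⁻¹ ∘ Φ = id`). [folklore] -/
theorem injective_mfderiv_diffeomorph
    (Φ : N ≃ₘ^∞⟮I', I⟯ M) (u : N) : Function.Injective (mfderiv I' I Φ u) := by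
  have hn : (∞ : ℕ∞ω) ≠ 0 := by simp
  have hc : mfderiv I' I' (Φ.symm ∘ Φ) u =
      (mfderiv I I' Φ.symm (Φ u)).comp (mfderiv I' I Φ u) :=
    mfderiv_comp u (Φ.symm.mdifferentiable hn (Φ u)) (Φ.mdifferentiable hn u)
  have hid : mfderiv I' I' (Φ.symm ∘ Φ) u = ContinuousLinearMap.id ℝ (TangentSpace I' u) := by
    have hcomp : (Φ.symm ∘ Φ : N → N) = id := funext fun v ↦ Φ.symm_apply_apply v
    rw [hcomp]
    exact mfderiv_id
  have key : ∀ z : TangentSpace I' u,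
      (mfderiv I I' Φ.symm (Φ u)) (mfderiv I' I Φ u z) = z := fun z ↦ by
    show ((mfderiv I I' Φ.symm (Φ u)).comp (mfderiv I' I Φ u)) z = z
    rw [← hc, hid]
    rfl
  intro v w hvw
  rw [← key v, ← key w, hvw]

omit g hpb hΦ hΦ' in
include hdim in
/-- **A manifold diffeomorphic to one carrying a Riemannian metric with `Rm ≥ −ε` carries one**
(pull back along the diffeomorphism; `contMDiff_pullbackBilin_holds` for the smoothness of the
pullback). This is how the limit metric of the printed proof lands on `Mᵢ`.
[cite: BamlerCabezasrivasWilking2019, proof of Corollary 3 (p. 15)] [cite: ONeill1983, Ch. 3, Prop. 3.59] -/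
theorem exists_isRiemannian_hasCurvatureOperatorGe_of_diffeomorph
    (Φ : N ≃ₘ^∞⟮I', I⟯ M) {ε : ℝ}
    (h : ∃ g : PseudoRiemannianMetric I ∞ E (TangentSpace I : M → Type _),
      g.IsRiemannian ∧ g.HasCurvatureOperatorGe ε) :
    ∃ g' : PseudoRiemannianMetric I' ∞ E' (TangentSpace I' : N → Type _),
      g'.IsRiemannian ∧ g'.HasCurvatureOperatorGe ε := by
  obtain ⟨g, hg, hge⟩ := h
  have hΦs : ContMDiff I' I (∞ + 1) Φ := Φ.contMDiff.of_le (by exact_mod_cast le_top)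
  have hΦi : ∀ u, Function.Injective (mfderiv I' I Φ u) := injective_mfderiv_diffeomorph Φ
  exact ⟨g.comap contMDiff_pullbackBilin_holds Φ hΦs hΦi hdim,
    hg.comap contMDiff_pullbackBilin_holds hΦs hΦi hdim,
    hge.comap contMDiff_pullbackBilin_holds hΦs hΦi hdim⟩

end Transport

/-- **Corollary 3 (1) from the output of Theorem 1 + Hamilton's compactness theorem.**  If for
every `k, D, v₀ > 0` and every sequence of closed smooth `k`-manifolds `(Mᵢ, gᵢ)` with
`diam ≤ D`, `vol ≥ v₀`, `Rm_{gᵢ} ≥ −1/(i+1)` there is a smooth `k`-manifold `M_∞` carrying a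
smooth Riemannian metric with non-negative curvature operator and diffeomorphic to some `Mᵢ`
(p. 15: "a limiting Ricci flow `(M_∞, g_∞(t))` … `Rm_{g_∞(t)} ∈ 𝒞` … the uniform diameter bound
ensures that `M_∞` is diffeomorphic to `Mᵢ` for all `i` large enough"), then the named fact holds:
pull the limit metric back to `Mᵢ` (`exists_isRiemannian_hasCurvatureOperatorGe_of_diffeomorph`)
and use the sequential form (`…_iff_seq`). [cite: BamlerCabezasrivasWilking2019, proof of Corollary 3 (p. 15)] -/
theorem BamlerCabezasRivasWilking2019_cor3_nonnegativeCurvatureOperator_of_limit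
    (H : ∀ (k : ℕ) (D v₀ : ℝ), 0 < D → 0 < v₀ →
      ∀ (M : ℕ → Type) [∀ i, TopologicalSpace (M i)] [∀ i, T2Space (M i)]
        [∀ i, SecondCountableTopology (M i)] [∀ i, CompactSpace (M i)]
        [∀ i, MeasurableSpace (M i)] [∀ i, BorelSpace (M i)]
        [∀ i, ChartedSpace (EuclideanSpace ℝ (Fin k)) (M i)] [∀ i, IsManifold (𝓡 k) ∞ (M i)]
        (g : ∀ i, PseudoRiemannianMetric (𝓡 k) ∞ (EuclideanSpace ℝ (Fin k))
          (TangentSpace (𝓡 k) : M i → Type _)),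
        (∀ i, (g i).IsRiemannian) →
        (∀ i (x y : M i), (g i).riemEDist x y ≤ ENNReal.ofReal D) →
        (∀ i, ENNReal.ofReal v₀ ≤ (g i).riemVolume Set.univ) →
        (∀ i, (g i).HasCurvatureOperatorGe (1 / ((i : ℝ) + 1))) →
          ∃ (M' : Type) (_ : TopologicalSpace M') (_ : ChartedSpace (EuclideanSpace ℝ (Fin k)) M')
            (_ : IsManifold (𝓡 k) ∞ M')
            (g' : PseudoRiemannianMetric (𝓡 k) ∞ (EuclideanSpace ℝ (Fin k))
              (TangentSpace (𝓡 k) : M' → Type _)),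
            g'.IsRiemannian ∧ g'.HasNonnegativeCurvatureOperator ∧
              ∃ i, Nonempty (M i ≃ₘ^∞⟮𝓡 k, 𝓡 k⟯ M')) :
    BamlerCabezasRivasWilking2019_cor3_nonnegativeCurvatureOperator := by
  rw [BamlerCabezasRivasWilking2019_cor3_nonnegativeCurvatureOperator_iff_seq]
  intro k D v₀ hD hv₀ M _ _ _ _ _ _ _ _ g hg hdiam hvol hRm
  obtain ⟨M', iT, iCh, iMan, g', hg', hN, i, ⟨Φ⟩⟩ := H k D v₀ hD hv₀ M g hg hdiam hvol hRm
  exact ⟨i, exists_isRiemannian_hasCurvatureOperatorGe_of_diffeomorph rfl Φ ⟨g', hg', hN⟩⟩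

/-! ### The two quoted theorems as hypotheses: Ricci-flow smoothing (Thm. 1) and compactness -/

/-- **Corollary 3 (1) from Theorem 1 and the compactness step, both as hypotheses.**
`H1` is the Ricci-flow smoothing of Bamler–Cabezas-Rivas–Wilking's Theorem 1 (p. 3: "the Ricci
flow `g(t)` with initial metric `g` exists until time `τ`, and we have the curvature bounds
`Rm_{g(t)} ≥ −Cε` and `|Rm_{g(t)}| ≤ C/t` for all `t ∈ (0, τ]`", `C, τ` depending on `n, v₀`
only) for CLOSED manifolds, with the hypothesis `vol_g(B_g(p, 1)) ≥ v₀ ∀ p` of the theorem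
replaced by the corollary's `diam ≤ D`, `vol(M) ≥ v₀` (the Bishop–Gromov step of the printed
proof, p. 15: "The volume and curvature conditions in (counter_cond) allow us to use Theorems 1
or 2") — so `τ, C` depend on `k, D, v₀`; the flow is a `IsRicciFlow` family on `[0, τ]`
(`RicciFlow.lean`) and `|Rm| ≤ C/t` is rendered on 2-vectors, `|Rm(φ, φ)| ≤ (C/t) |φ|²`.
`H2` is the compactness step (p. 15: "The latter curvature control and the volume bound … yield,
by means of Hamilton's compactness theorem, a limiting Ricci flow `(M_∞, g_∞(t))_{t ∈ (0, τ]}`.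
By definition of Cheeger–Gromov convergence the curvature condition … passes to the limit, and
hence `Rm_{g_∞(t)} ∈ 𝒞`. Finally the uniform diameter bound … ensures that `M_∞` is diffeomorphic
to `Mᵢ` for all `i` large enough"): from such flows on a sequence with `Rm_{gᵢ} ≥ −1/(i+1)` it
delivers a smooth `k`-manifold with a Riemannian `Rm ≥ 0` metric diffeomorphic to some `Mᵢ`.
Given both, the named fact follows (`…_of_limit`). Neither `H1` nor `H2` is available in the
tree. [cite: BamlerCabezasrivasWilking2019, Theorem 1 (p. 3) and proof of Corollary 3 (p. 15)] -/
theorem BamlerCabezasRivasWilking2019_cor3_nonnegativeCurvatureOperator_of_ricciFlow_of_compactness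
    (H1 : ∀ (k : ℕ) (D v₀ : ℝ), 0 < D → 0 < v₀ → ∃ τ C : ℝ, 0 < τ ∧ 0 < C ∧
      ∀ (M : Type) [TopologicalSpace M] [T2Space M] [SecondCountableTopology M] [CompactSpace M]
        [MeasurableSpace M] [BorelSpace M]
        [ChartedSpace (EuclideanSpace ℝ (Fin k)) M] [IsManifold (𝓡 k) ∞ M]
        (g₀ : PseudoRiemannianMetric (𝓡 k) ∞ (EuclideanSpace ℝ (Fin k))
          (TangentSpace (𝓡 k) : M → Type _)),
        g₀.IsRiemannian →
        (∀ x y : M, g₀.riemEDist x y ≤ ENNReal.ofReal D) →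
        ENNReal.ofReal v₀ ≤ g₀.riemVolume Set.univ →
        ∀ ε : ℝ, 0 < ε → ε ≤ 1 → g₀.HasCurvatureOperatorGe ε →
          ∃ (g : ℝ → PseudoRiemannianMetric (𝓡 k) ∞ (EuclideanSpace ℝ (Fin k))
              (TangentSpace (𝓡 k) : M → Type _))
            (cov : ℝ → CovariantDerivative (𝓡 k) (EuclideanSpace ℝ (Fin k))
              (TangentSpace (𝓡 k) : M → Type _)),
            g 0 = g₀ ∧ IsRicciFlow g cov (Set.Icc 0 τ) ∧
            ∀ t ∈ Set.Ioc 0 τ, (g t).IsRiemannian ∧ (g t).HasCurvatureOperatorGe (C * ε) ∧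
              ∀ (x : M) (m : ℕ) (X Y : Fin m → TangentSpace (𝓡 k) x),
                |(g t).curvatureOperatorForm (cov t) x X Y| ≤ C / t * (g t).bivectorNormSq x X Y)
    (H2 : ∀ (k : ℕ) (D v₀ τ C : ℝ), 0 < D → 0 < v₀ → 0 < τ → 0 < C →
      ∀ (M : ℕ → Type) [∀ i, TopologicalSpace (M i)] [∀ i, T2Space (M i)]
        [∀ i, SecondCountableTopology (M i)] [∀ i, CompactSpace (M i)]
        [∀ i, MeasurableSpace (M i)] [∀ i, BorelSpace (M i)]
        [∀ i, ChartedSpace (EuclideanSpace ℝ (Fin k)) (M i)] [∀ i, IsManifold (𝓡 k) ∞ (M i)]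
        (g₀ : ∀ i, PseudoRiemannianMetric (𝓡 k) ∞ (EuclideanSpace ℝ (Fin k))
          (TangentSpace (𝓡 k) : M i → Type _)),
        (∀ i, (g₀ i).IsRiemannian) →
        (∀ i (x y : M i), (g₀ i).riemEDist x y ≤ ENNReal.ofReal D) →
        (∀ i, ENNReal.ofReal v₀ ≤ (g₀ i).riemVolume Set.univ) →
        (∀ i, (g₀ i).HasCurvatureOperatorGe (1 / ((i : ℝ) + 1))) →
        ∀ (g : ∀ i, ℝ → PseudoRiemannianMetric (𝓡 k) ∞ (EuclideanSpace ℝ (Fin k))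
            (TangentSpace (𝓡 k) : M i → Type _))
          (cov : ∀ i, ℝ → CovariantDerivative (𝓡 k) (EuclideanSpace ℝ (Fin k))
            (TangentSpace (𝓡 k) : M i → Type _)),
          (∀ i, g i 0 = g₀ i) → (∀ i, IsRicciFlow (g i) (cov i) (Set.Icc 0 τ)) →
          (∀ i, ∀ t ∈ Set.Ioc 0 τ, (g i t).IsRiemannian ∧
            (g i t).HasCurvatureOperatorGe (C * (1 / ((i : ℝ) + 1))) ∧
            ∀ (x : M i) (m : ℕ) (X Y : Fin m → TangentSpace (𝓡 k) x),
              |(g i t).curvatureOperatorForm (cov i t) x X Y| ≤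
                C / t * (g i t).bivectorNormSq x X Y) →
            ∃ (M' : Type) (_ : TopologicalSpace M') (_ : ChartedSpace (EuclideanSpace ℝ (Fin k)) M')
              (_ : IsManifold (𝓡 k) ∞ M')
              (g' : PseudoRiemannianMetric (𝓡 k) ∞ (EuclideanSpace ℝ (Fin k))
                (TangentSpace (𝓡 k) : M' → Type _)),
              g'.IsRiemannian ∧ g'.HasNonnegativeCurvatureOperator ∧
                ∃ i, Nonempty (M i ≃ₘ^∞⟮𝓡 k, 𝓡 k⟯ M')) :
    BamlerCabezasRivasWilking2019_cor3_nonnegativeCurvatureOperator := by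
  refine BamlerCabezasRivasWilking2019_cor3_nonnegativeCurvatureOperator_of_limit
    fun k D v₀ hD hv₀ M _ _ _ _ _ _ _ _ g₀ hg₀ hdiam hvol hRm ↦ ?_
  obtain ⟨τ, C, hτ, hC, hflow⟩ := H1 k D v₀ hD hv₀
  have hεpos : ∀ i : ℕ, (0 : ℝ) < 1 / ((i : ℝ) + 1) := fun i ↦ by positivity
  have hεle : ∀ i : ℕ, 1 / ((i : ℝ) + 1) ≤ 1 := fun i ↦ by
    rw [div_le_one (by positivity)]
    linarith [(Nat.cast_nonneg i : (0 : ℝ) ≤ i)]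
  choose g cov hg0 hRF hbounds using fun i : ℕ ↦
    hflow (M i) (g₀ i) (hg₀ i) (hdiam i) (hvol i) (1 / ((i : ℝ) + 1)) (hεpos i) (hεle i) (hRm i)
  exact H2 k D v₀ τ C hD hv₀ hτ hC M g₀ hg₀ hdiam hvol hRm g cov hg0 hRF hbounds

/-! ### The model: the unit round sphere (`I(φ, φ) = |φ|²`) -/

section RoundSphere

variable (V : Type*) [NormedAddCommGroup V] [InnerProductSpace ℝ V] {m : ℕ}
  [Fact (finrank ℝ V = m + 1)]

/-- **`Rm_{Sᵐ}(φ, φ) = |φ|²`**: for the unit round sphere and any of its Levi-Civita connections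
the curvature operator form is the squared norm of the 2-vector — the normalisation "`I` denotes
the curvature operator of the unit round `n`-sphere" of Bamler–Cabezas-Rivas–Wilking (p. 3), so
that the tree's `−ε |φ|² ≤ Rm(φ, φ)` is exactly "`Rm + ε I` is non-negative definite". From the
proved constant curvature `1` of the round metric (`hasConstantSectionalCurvature_roundMetric`).
[cite: BamlerCabezasrivasWilking2019, §1 (remark after Theorem 1, p. 3)] [cite: Lee2018, Thm. 8.34 (b)] -/
theorem curvatureOperatorForm_roundMetric
    {cov : CovariantDerivative (𝓡 m) (EuclideanSpace ℝ (Fin m))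
      (TangentSpace (𝓡 m) : Metric.sphere (0 : V) 1 → Type _)}
    (h : (roundMetric (n := m) V).IsLeviCivita cov) (x : Metric.sphere (0 : V) 1) {k : ℕ}
    (X Y : Fin k → TangentSpace (𝓡 m) x) :
    (roundMetric (n := m) V).curvatureOperatorForm cov x X Y =
      (roundMetric (n := m) V).bivectorNormSq x X Y := by
  rw [(hasConstantSectionalCurvatureWith_roundMetric V h).curvatureOperatorForm_eq, one_mul]

/-- **The unit round sphere has non-negative curvature operator** (curvature condition (1);
indeed `Rm(φ, φ) = |φ|² ≥ 0`). [cite: BamlerCabezasrivasWilking2019, Theorem 2 (1)]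
[cite: Hamilton1986, §1, pp. 153–154] -/
theorem hasNonnegativeCurvatureOperator_roundMetric :
    (roundMetric (n := m) V).HasNonnegativeCurvatureOperator :=
  (hasConstantSectionalCurvature_roundMetric V).hasNonnegativeCurvatureOperator
    isRiemannian_roundMetric zero_le_one

/-- **The unit round sphere satisfies `Rm ≥ −ε` for every `ε ≥ −1`** (`Rm = I`); in particular
it lies in the hypothesis class of Theorem 1 / Corollary 3 for every `ε ≥ 0`.
[cite: BamlerCabezasrivasWilking2019, §1 (Theorem 1)] -/
theorem hasCurvatureOperatorGe_roundMetric {ε : ℝ} (hε : -1 ≤ ε) :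
    (roundMetric (n := m) V).HasCurvatureOperatorGe ε :=
  (hasConstantSectionalCurvature_roundMetric V).hasCurvatureOperatorGe isRiemannian_roundMetric hε

end RoundSphere

end Literature.Geometry.Riemannian
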